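import Literature.Barriers.NavierStokesRegularity.NavierStokesInequalityProfilesH
import Literature.Barriers.NavierStokesRegularity.NavierStokesInequalityProfileConvergence
import Literature.Barriers.NavierStokesRegularity.NavierStokesInequalityProfiles
import HarnessLib

/-!
# The profiles `qᵏ_{i,t}` of Ożański's §4.1 ((4.16)) and the verification of §4.2

Barrier catalogue support file for `NavierStokesRegularity` (D-0021), on the discharge path of
fact D-II `Literature.Barriers.NavierStokesRegularity.NSIProfiles_of_arrangement`
(`NavierStokesInequalityProfiles`; W. S. Ożański, arXiv:1709.00602v4, §4.1–4.2; V. Scheffer,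
Comm. Math. Phys. 101 (1985), Lemma 3.2). Given the data of Lemma 4.1 (`IsHProfileData` of
`NavierStokesInequalityProfilesH`: `δ`, the clamp `κ`, `h₁ = H 0`, `h₂ = H 1`) and oscillatory
processes `aᵢᵏ` (`IsOscFamily`, Theorem 4.3), the profiles of (4.16),

  `(qᵏ_{i,t})² = fᵢ² - 2tδφᵢ - ∫₀ᵗ aᵢᵏ(s) vᵢ·(∇h²_{i,s} + 2∇p[a₁ᵏ(s)v₁,h_{1,s}] + 2∇p[a₂ᵏ(s)v₂,h_{2,s}]) ds`,

are built here in the EXPANDED form furnished by `NavierStokesInequalityPressureScaling`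
(`∇p[bv,h] = ∇p[0,h] - b² F[v,h]`): the integrand is
`aᵢᵏ(s)(gᵢ(s,x) + a₁ᵏ(s)² f_{i,1}(s,x) + a₂ᵏ(s)² f_{i,2}(s,x))` with
`gᵢ = vᵢ·(∇h²ᵢ + 2∇p[0,h₁] + 2∇p[0,h₂])` (`gFam`) and `f_{i,l} = -2vᵢ·F[v_l,h_l]` (`fFam`),
i.e. `(qᵏ_{i,t})² = qRad … = fᵢ² - 2κ(t)δφᵢ - oscIntegral a gFam fFam k i t` (`link` lemma
`inner_grad_profilePotential`). Then (Ożański §4.1–4.2, here in the tree's rendering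
`IsNSIProfileData` with `Cᵢ = {φᵢ ≥ 1/4}` and slack `δ/4`):

* `(qᵏ_{i,t})² - h²_{i,t} = -oscError … t` for `t ∈ [0,T]` ((4.16) versus (4.9): `h²_{i,t}` is
  `fᵢ² - 2tδφᵢ - oscLimit`), so by `IsOscFamily.oscError_small_two` ((4.18)/(4.22)) it is
  uniformly small with two derivatives for `k` large (`IsQData.exists_good`);
* `∂ₜ(qᵏ_{i,t})² = -2δφᵢ - aᵢᵏ(t)vᵢ·∇(h²_{i,t} + 2p[a₁ᵏv₁,h_{1,t}] + 2p[a₂ᵏv₂,h_{2,t}])` ((4.17));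
* on `Cᵢ`: the inner inequality (Scheffer (2.6); Ożański §4.2, Case 2, (4.27)) with the error
  `|vᵢ·∇(Ψ^q - Ψ^h)| ≤ δ/4` from the first lemma of Appendix A.3
  (`exists_planePressure_sub_le`) and the `C²`-smallness; off `Cᵢ`: `vᵢ = 0`,
  `∂ₜ(qᵏ)² = -2δφᵢ ≤ 0` and `q L(q) ≥ 0` (Case 1; the perturbation criterion
  `DampedCriterion` of `NavierStokesInequalityProfilePerturbation`, `qᵏ_{i,t} = √(fᵢ² - 2tδφᵢ)`
  on `{φᵢ < 1}`);
* `qᵏ_{i,t} > |vᵢ|` on `Uᵢ` for `t` in an open interval around `[0,T]` ((4.19)–(4.20), "by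
  continuity", a tube-lemma argument: `exists_eta`), smoothness there, `qᵏ_{i,0} = fᵢ`, and the
  gain from (4.11);
* `IsQData.exists_profileData` — the assembled `IsNSIProfileData`, and
  `IsNSIArrangement.exists_profileData` — **every geometric arrangement carries profile data**
  (the content of fact D-II; the named statement `NSIProfiles_of_arrangement` is discharged in
  `NavierStokesInequalityProfilesProofs`).

Indices `i ∈ Fin 2` (`0 ↦ 1`, `1 ↦ 2`); the two structures, fields, profiles and cut-offs are
`Fin 2`-indexed families `U, V, f, φ, ψ, H`.

## References

* W. S. Ożański, *On weak solutions to the Navier–Stokes inequality with internal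
  singularities*, arXiv:1709.00602v4, §4.1 ((4.16)–(4.20)), §4.2 (Cases 1–2, (4.23)–(4.27)),
  §4.3 ((4.22), Theorem 4.3), Appendix A.3. [`Ozanski2017NSISingular`]
* V. Scheffer, *A solution to the Navier–Stokes inequality with an internal singularity*,
  Comm. Math. Phys. 101 (1985), Lemma 2.1 ((2.1)–(2.9)), Lemma 3.2 ((3.34)–(3.58)), Lemma 3.3.
  [`Scheffer1985`]
-/

noncomputable section

open Set Function Filter Topology Metric MeasureTheory intervalIntegral
open scoped ContDiff

namespace Literature.Barriers.NavierStokesRegularity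

open Literature.Analysis.FluidPDE

-- nested operator types `ℝ² →L[ℝ] ℝ² →L[ℝ] ℝ` (second derivatives)
set_option maxSynthPendingDepth 3

/-- Local notation for physical space `ℝ³ = EuclideanSpace ℝ (Fin 3)`. -/
local notation "ℝ³" => EuclideanSpace ℝ (Fin 3)

/-! ### The expanded families of (4.16) -/

/-- **`gᵢ(s,x) = vᵢ·∇h²_{i,s} + 2vᵢ·∇p[0,h_{1,s}] + 2vᵢ·∇p[0,h_{2,s}]`** — the direction-independent
part of the integrand of (4.16) (after `∇p[bv_l,h_l] = ∇p[0,h_l] - b²F[v_l,h_l]`).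
[cite: Ozanski2017NSISingular, §4.1 (4.16)] -/
def gFam (V : Fin 2 → ℝ × ℝ → ℝ × ℝ) (H : Fin 2 → ℝ → ℝ × ℝ → ℝ) : Fin 2 → ℝ → ℝ × ℝ → ℝ :=
  fun i s x =>
    (V i x).1 * derivR (fun y => H i s y ^ 2) x + (V i x).2 * derivZ (fun y => H i s y ^ 2) x +
      2 * ((V i x).1 * derivR (planePressure 0 (H 0 s)) x +
            (V i x).2 * derivZ (planePressure 0 (H 0 s)) x +
          ((V i x).1 * derivR (planePressure 0 (H 1 s)) x +
            (V i x).2 * derivZ (planePressure 0 (H 1 s)) x))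

/-- **`f_{i,l}(s,x) = -2vᵢ·F[v_l,h_{l,s}]`** — the coefficient of `a_lᵏ(s)²` in the integrand of
(4.16) (`F_{i,l}(x,s,b) = b² f_{i,l}(s,x)`; `½(F_{2,1}(1) - F_{2,1}(0)) = -v₂·F[v₁,h₁]`, (4.22)
versus (4.9)). [cite: Ozanski2017NSISingular, §4.1 (4.16) and §4.3 (4.22)] -/
def fFam (V : Fin 2 → ℝ × ℝ → ℝ × ℝ) (H : Fin 2 → ℝ → ℝ × ℝ → ℝ) :
    Fin 2 → Fin 2 → ℝ → ℝ × ℝ → ℝ :=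
  fun i l s x =>
    -2 * ((V i x).1 * (pressureInteraction (V l) (H l s) x).1 +
      (V i x).2 * (pressureInteraction (V l) (H l s) x).2)

/-- **The radicand `(qᵏ_{i,t})²` of (4.16)**: `fᵢ² - 2κ(t)δφᵢ - oscIntegral` (time clamped as
for `h`; `κ = id` on `[0,T]`). [cite: Ozanski2017NSISingular, §4.1 (4.16)] -/
def qRad (f φ : Fin 2 → ℝ × ℝ → ℝ) (δ : ℝ) (κ : ℝ → ℝ) (a : ℕ → Fin 2 → ℝ → ℝ)
    (V : Fin 2 → ℝ × ℝ → ℝ × ℝ) (H : Fin 2 → ℝ → ℝ × ℝ → ℝ) (k : ℕ) (i : Fin 2) (t : ℝ)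
    (x : ℝ × ℝ) : ℝ :=
  f i x ^ 2 - 2 * κ t * δ * φ i x - oscIntegral a (gFam V H) (fFam V H) k i t x

/-- **`qᵏ_{i,t} = √((qᵏ_{i,t})²)`** ((4.16)). [cite: Ozanski2017NSISingular, §4.1 (4.16)] -/
def qProf (f φ : Fin 2 → ℝ × ℝ → ℝ) (δ : ℝ) (κ : ℝ → ℝ) (a : ℕ → Fin 2 → ℝ → ℝ)
    (V : Fin 2 → ℝ × ℝ → ℝ × ℝ) (H : Fin 2 → ℝ → ℝ × ℝ → ℝ) (k : ℕ) (i : Fin 2) (t : ℝ)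
    (x : ℝ × ℝ) : ℝ :=
  Real.sqrt (qRad f φ δ κ a V H k i t x)

/-! ### The hypotheses: Lemma 4.1 data and oscillatory processes, `Fin 2`-indexed -/

/-- **The input of §4.1–4.2**: two structures `(Vᵢ, fᵢ, φᵢ)` on `Uᵢ`; the slack `δ > 0` and the
clamp `κ` of Lemma 4.1; gaps and perturbation criteria on `[-1,T+1]`; the profiles
`Hᵢ = h_{i,·}` jointly smooth, giving structures `(bVᵢ, H_{i,t}, ψᵢ)` for all `t`, `|b| ≤ 1`,
with squares `H²_{i,t} = fᵢ² - 2κ(t)δφᵢ - oscLimit(f)ᵢ(κ t)` ((4.9): `oscLimit` is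
`-∫₀ᵗ v₂·F[v₁,h₁]` for `i = 2`, `0` for `i = 1`); and an oscillatory family `a` (Theorem 4.3).
[cite: Ozanski2017NSISingular, Lemma 4.1 and §4.1] -/
structure IsQData (U : Fin 2 → Set (ℝ × ℝ)) (V : Fin 2 → ℝ × ℝ → ℝ × ℝ)
    (f φ ψ : Fin 2 → ℝ × ℝ → ℝ) (H : Fin 2 → ℝ → ℝ × ℝ → ℝ) (T δ : ℝ) (κ : ℝ → ℝ)
    (a : ℕ → Fin 2 → ℝ → ℝ) : Prop where
  /-- The two structures. -/
  isNSIStructure : ∀ i, IsNSIStructure (U i) (V i) (f i) (φ i)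
  /-- `δ > 0`. -/
  δ_pos : 0 < δ
  /-- `T > 0`. -/
  T_pos : 0 < T
  /-- The clamp is smooth, -/
  κ_smooth : ContDiff ℝ ∞ κ
  /-- the identity on `[0,T]`, -/
  κ_eq : ∀ t ∈ Icc (0 : ℝ) T, κ t = t
  /-- with derivative `1` there, -/
  deriv_κ_eq : ∀ t ∈ Icc (0 : ℝ) T, deriv κ t = 1
  /-- and range in `[-1, T+1]`. -/
  κ_mem : ∀ t, κ t ∈ Icc (-1 : ℝ) (T + 1)
  /-- The gaps on `supp φᵢ`. -/
  gap : ∀ i, ∃ m > 0, ∀ t ∈ Icc (-1 : ℝ) (T + 1), ∀ x ∈ tsupport (φ i),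
    (V i x).1 ^ 2 + (V i x).2 ^ 2 + m ≤ f i x ^ 2 - 2 * t * δ * φ i x
  /-- The perturbation criteria. -/
  crit : ∀ i, DampedCriterion (U i) (V i) (f i) (φ i) (ψ i) δ T
  /-- `Hᵢ` is jointly smooth. -/
  H_smooth : ∀ i, ContDiff ℝ ∞ (uncurry (H i))
  /-- `(bVᵢ, H_{i,t}, ψᵢ)` is a structure on `Uᵢ`. -/
  H_str : ∀ i t, ∀ b : ℝ, |b| ≤ 1 → IsNSIStructure (U i) (b • V i) (H i t) (ψ i)
  /-- (4.9): `H²_{i,t} = fᵢ² - 2κ(t)δφᵢ - oscLimit(f)ᵢ(κ t)`. -/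
  H_sq : ∀ i t x, H i t x ^ 2 = f i x ^ 2 - 2 * κ t * δ * φ i x - oscLimit (fFam V H) i (κ t) x
  /-- The oscillatory processes (Theorem 4.3). -/
  osc : IsOscFamily T a

namespace IsQData

variable {U : Fin 2 → Set (ℝ × ℝ)} {V : Fin 2 → ℝ × ℝ → ℝ × ℝ} {f φ ψ : Fin 2 → ℝ × ℝ → ℝ}
  {H : Fin 2 → ℝ → ℝ × ℝ → ℝ} {T δ : ℝ} {κ : ℝ → ℝ} {a : ℕ → Fin 2 → ℝ → ℝ}

/-! ### Basic consequences -/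

/-- `(Vᵢ, H_{i,t}, ψᵢ)` is a structure. [cite: Ozanski2017NSISingular, Lemma 4.1 (4.10)] -/
theorem H_str_one (hQ : IsQData U V f φ ψ H T δ κ a) (i : Fin 2) (t : ℝ) :
    IsNSIStructure (U i) (V i) (H i t) (ψ i) := by
  simpa using hQ.H_str i t 1 (by norm_num)

/-- `(0, H_{i,t}, ψᵢ)` is a structure. [cite: Ozanski2017NSISingular, Lemma 4.1 (4.10)] -/
theorem H_str_zero (hQ : IsQData U V f φ ψ H T δ κ a) (i : Fin 2) (t : ℝ) :
    IsNSIStructure (U i) 0 (H i t) (ψ i) := by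
  simpa using hQ.H_str i t 0 (by norm_num)

/-- `Vᵢ = 0` on `{φᵢ < 1}`. [cite: Ozanski2017NSISingular, Definition 3.3] -/
theorem V_eq_zero_of_lt (hQ : IsQData U V f φ ψ H T δ κ a) {i : Fin 2} {x : ℝ × ℝ}
    (hx : φ i x < 1) : V i x = 0 :=
  (hQ.isNSIStructure i).v_eq_zero_of_lt hx

/-- `Vᵢ = 0` off `supp φᵢ`. [folklore] -/
theorem V_eq_zero_of_notMem (hQ : IsQData U V f φ ψ H T δ κ a) {i : Fin 2} {x : ℝ × ℝ}
    (hx : x ∉ tsupport (φ i)) : V i x = 0 :=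
  hQ.V_eq_zero_of_lt (by rw [image_eq_zero_of_notMem_tsupport hx]; norm_num)

/-- The compact parameter set `P = Ū₁ ∪ Ū₂`. [cite: Ozanski2017NSISingular, §4.3 (Theorem 4.3: "uniformly in `(x,t) ∈ P × [0,T]`")] -/
theorem isCompact_P (hQ : IsQData U V f φ ψ H T δ κ a) : IsCompact (closure (U 0) ∪ closure (U 1)) :=
  (hQ.isNSIStructure 0).isCompact_closure.union (hQ.isNSIStructure 1).isCompact_closure

/-- Off `P` both planar fields vanish. [folklore] -/
theorem V_eq_zero_of_notMem_P (hQ : IsQData U V f φ ψ H T δ κ a) {x : ℝ × ℝ}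
    (hx : x ∉ closure (U 0) ∪ closure (U 1)) (i : Fin 2) : V i x = 0 := by
  fin_cases i
  · exact (hQ.isNSIStructure 0).v_eq_zero fun h => hx (Or.inl h)
  · exact (hQ.isNSIStructure 1).v_eq_zero fun h => hx (Or.inr h)

/-! ### Smoothness of the families -/

/-- `(s,y) ↦ H²_{i,s}(y)` is jointly smooth. [folklore] -/
theorem contDiff_H_sq (hQ : IsQData U V f φ ψ H T δ κ a) (i : Fin 2) :
    ContDiff ℝ ∞ (uncurry fun (s : ℝ) (y : ℝ × ℝ) => H i s y ^ 2) :=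
  (hQ.H_smooth i).pow 2

/-- `(s,x) ↦ ∂ᵣ p[0,H_{l,s}](x)` is jointly smooth. [cite: Ozanski2017NSISingular, §4.1 (4.16) and (3.21)] -/
theorem contDiff_derivR_planePressure_zero (hQ : IsQData U V f φ ψ H T δ κ a) (l : Fin 2) :
    ContDiff ℝ ∞ fun p : ℝ × (ℝ × ℝ) => derivR (planePressure 0 (H l p.1)) p.2 := by
  have h := contDiff_derivR_planePressure_family (hQ.isNSIStructure l) (b := 0) (by norm_num)
    (hQ.H_smooth l) (fun t q => (hQ.H_str_one l t).f_nonneg q)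
    (fun t _ hq => (hQ.H_str_one l t).f_eq_zero hq) (fun t q hq => (hQ.H_str_one l t).sq_lt q hq)
  simpa using h

/-- `(s,x) ↦ ∂_z p[0,H_{l,s}](x)` is jointly smooth. [cite: Ozanski2017NSISingular, §4.1 (4.16) and (3.21)] -/
theorem contDiff_derivZ_planePressure_zero (hQ : IsQData U V f φ ψ H T δ κ a) (l : Fin 2) :
    ContDiff ℝ ∞ fun p : ℝ × (ℝ × ℝ) => derivZ (planePressure 0 (H l p.1)) p.2 := by
  have h := contDiff_derivZ_planePressure_family (hQ.isNSIStructure l) (b := 0) (by norm_num)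
    (hQ.H_smooth l) (fun t q => (hQ.H_str_one l t).f_nonneg q)
    (fun t _ hq => (hQ.H_str_one l t).f_eq_zero hq) (fun t q hq => (hQ.H_str_one l t).sq_lt q hq)
  simpa using h

/-- `(s,x) ↦ F[V_l, H_{l,s}](x)` is jointly smooth. [cite: Ozanski2017NSISingular, §3.6 (3.34) and §4.1] -/
theorem contDiff_pressureInteraction (hQ : IsQData U V f φ ψ H T δ κ a) (l : Fin 2) :
    ContDiff ℝ ∞ fun p : ℝ × (ℝ × ℝ) => pressureInteraction (V l) (H l p.1) p.2 :=
  contDiff_pressureInteraction_family (hQ.isNSIStructure l) (hQ.H_smooth l)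
    (fun t q => (hQ.H_str_one l t).f_nonneg q) (fun t _ hq => (hQ.H_str_one l t).f_eq_zero hq)
    (fun t q hq => (hQ.H_str_one l t).sq_lt q hq)

/-- **`gᵢ` is jointly smooth in `(s,x)`.** [cite: Ozanski2017NSISingular, §4.1 ("all terms on the right-hand side of (4.16) are smooth")] -/
theorem contDiff_gFam (hQ : IsQData U V f φ ψ H T δ κ a) (i : Fin 2) :
    ContDiff ℝ ∞ (uncurry (gFam V H i)) := by
  have hv : ContDiff ℝ ∞ fun p : ℝ × (ℝ × ℝ) => V i p.2 :=
    (hQ.isNSIStructure i).v_smooth.comp contDiff_snd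
  have hv1 := contDiff_fst.comp hv
  have hv2 := contDiff_snd.comp hv
  have hR := (hQ.contDiff_H_sq i).derivR_param (P := fun s y => H i s y ^ 2)
  have hZ := (hQ.contDiff_H_sq i).derivZ_param (P := fun s y => H i s y ^ 2)
  have h0R := hQ.contDiff_derivR_planePressure_zero 0
  have h0Z := hQ.contDiff_derivZ_planePressure_zero 0
  have h1R := hQ.contDiff_derivR_planePressure_zero 1
  have h1Z := hQ.contDiff_derivZ_planePressure_zero 1
  exact ((hv1.mul hR).add (hv2.mul hZ)).add (contDiff_const.mul
    (((hv1.mul h0R).add (hv2.mul h0Z)).add ((hv1.mul h1R).add (hv2.mul h1Z))))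

/-- **`f_{i,l}` is jointly smooth in `(s,x)`.** [cite: Ozanski2017NSISingular, §4.1 ("all terms on the right-hand side of (4.16) are smooth")] -/
theorem contDiff_fFam (hQ : IsQData U V f φ ψ H T δ κ a) (i l : Fin 2) :
    ContDiff ℝ ∞ (uncurry (fFam V H i l)) := by
  have hv : ContDiff ℝ ∞ fun p : ℝ × (ℝ × ℝ) => V i p.2 :=
    (hQ.isNSIStructure i).v_smooth.comp contDiff_snd
  have hF := hQ.contDiff_pressureInteraction l
  exact contDiff_const.mul (((contDiff_fst.comp hv).mul (contDiff_fst.comp hF)).add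
    ((contDiff_snd.comp hv).mul (contDiff_snd.comp hF)))

/-! ### Vanishing where `Vᵢ = 0` -/

/-- `gᵢ(s,x) = 0` where `Vᵢ(x) = 0`. [folklore] -/
theorem gFam_eq_zero {i : Fin 2} {x : ℝ × ℝ} (hx : V i x = 0) (s : ℝ) : gFam V H i s x = 0 := by
  simp [gFam, hx]

/-- `f_{i,l}(s,x) = 0` where `Vᵢ(x) = 0`. [folklore] -/
theorem fFam_eq_zero {i : Fin 2} (l : Fin 2) {x : ℝ × ℝ} (hx : V i x = 0) (s : ℝ) :
    fFam V H i l s x = 0 := by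
  simp [fFam, hx]

/-- The oscillatory integral vanishes where `Vᵢ = 0`. [folklore] -/
theorem oscIntegral_eq_zero {i : Fin 2} {x : ℝ × ℝ} (hx : V i x = 0) (k : ℕ) (t : ℝ) :
    oscIntegral a (gFam V H) (fFam V H) k i t x = 0 := by
  simp [oscIntegral, gFam_eq_zero hx, fFam_eq_zero _ hx]

/-- The limit vanishes where `Vᵢ = 0`. [folklore] -/
theorem oscLimit_eq_zero {i : Fin 2} {x : ℝ × ℝ} (hx : V i x = 0) (t : ℝ) :
    oscLimit (fFam V H) i t x = 0 := by
  by_cases hi : i = 1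
  · subst hi; simp [oscLimit, fFam_eq_zero _ hx]
  · simp [oscLimit, hi]

/-- The error vanishes where `Vᵢ = 0`. [folklore] -/
theorem oscError_eq_zero {i : Fin 2} {x : ℝ × ℝ} (hx : V i x = 0) (k : ℕ) (t : ℝ) :
    oscError a (gFam V H) (fFam V H) k i t x = 0 := by
  rw [oscError, oscIntegral_eq_zero hx, oscLimit_eq_zero hx, sub_zero]

/-- Where `Vᵢ = 0` the radicand is the damped radicand `fᵢ² - 2κ(t)δφᵢ`. [cite: Ozanski2017NSISingular, §4.1 ("`qᵏ_{i,t}` differs from `fᵢ` only on `supp φᵢ`")] -/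
theorem qRad_of_V_eq_zero {i : Fin 2} {x : ℝ × ℝ} (hx : V i x = 0) (k : ℕ) (t : ℝ) :
    qRad f φ δ κ a V H k i t x = f i x ^ 2 - 2 * κ t * δ * φ i x := by
  rw [qRad, oscIntegral_eq_zero hx, sub_zero]

/-- **(4.16) versus (4.9): `(qᵏ_{i,t})² - H²_{i,t} = -oscError` at times with `κ(t) = t`.**
[cite: Ozanski2017NSISingular, §4.1 (4.16) and Lemma 4.1 (4.9)] -/
theorem qRad_sub_H_sq (hQ : IsQData U V f φ ψ H T δ κ a) (k : ℕ) (i : Fin 2) {t : ℝ}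
    (ht : κ t = t) (x : ℝ × ℝ) :
    qRad f φ δ κ a V H k i t x - H i t x ^ 2 = -oscError a (gFam V H) (fFam V H) k i t x := by
  rw [qRad, hQ.H_sq i t x, ht, oscError]
  ring

/-! ### The link with the planar potential ((4.16)–(4.17) and (4.26)) -/

/-- **Expansion of the transport pairing**: for profiles `Q_l` giving structures `(bV_l, Q_{l,s}, ψ_l)`
and directions `|A_l(s)| ≤ 1`,
`Vᵢ·∇(Qᵢ² + 2p[A₀V₀,Q₀] + 2p[A₁V₁,Q₁])(x) = Vᵢ·∇Qᵢ²(x) + 2Σ_l (Vᵢ·∇p[0,Q_l](x) - A_l² Vᵢ·F[V_l,Q_l](x))`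
(sum rule and `∇p[bv,h] = ∇p[0,h] - b²F[v,h]`). [cite: Ozanski2017NSISingular, §4.2 (4.26) and Lemma 3.2 (i)] -/
theorem inner_grad_profilePotential {Q : Fin 2 → ℝ → ℝ × ℝ → ℝ} {A : Fin 2 → ℝ → ℝ} (s : ℝ)
    (hQs : ∀ l, ContDiff ℝ ∞ (Q l s))
    (hQstr : ∀ l, ∀ b : ℝ, |b| ≤ 1 → IsNSIStructure (U l) (b • V l) (Q l s) (ψ l))
    (hA : ∀ l, |A l s| ≤ 1) (i : Fin 2) (x : ℝ × ℝ) :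
    (V i x).1 * derivR (profilePotential (V 0) (V 1) (A 0) (A 1) (Q 0) (Q 1) (Q i) s) x +
        (V i x).2 * derivZ (profilePotential (V 0) (V 1) (A 0) (A 1) (Q 0) (Q 1) (Q i) s) x =
      (V i x).1 * derivR (fun y => Q i s y ^ 2) x + (V i x).2 * derivZ (fun y => Q i s y ^ 2) x +
        2 * (((V i x).1 * derivR (planePressure 0 (Q 0 s)) x +
              (V i x).2 * derivZ (planePressure 0 (Q 0 s)) x -
            A 0 s ^ 2 * ((V i x).1 * (pressureInteraction (V 0) (Q 0 s) x).1 +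
              (V i x).2 * (pressureInteraction (V 0) (Q 0 s) x).2)) +
          ((V i x).1 * derivR (planePressure 0 (Q 1 s)) x +
              (V i x).2 * derivZ (planePressure 0 (Q 1 s)) x -
            A 1 s ^ 2 * ((V i x).1 * (pressureInteraction (V 1) (Q 1 s) x).1 +
              (V i x).2 * (pressureInteraction (V 1) (Q 1 s) x).2))) := by
  have h1 : ∀ l, IsNSIStructure (U l) (V l) (Q l s) (ψ l) := fun l => by
    simpa using hQstr l 1 (by norm_num)
  -- differentiability of the three summands
  have hdq : DifferentiableAt ℝ (fun y => Q i s y ^ 2) x :=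
    (((hQs i).pow 2).differentiable (by simp)) x
  have hdp : ∀ l, DifferentiableAt ℝ (planePressure (A l s • V l) (Q l s)) x := fun l =>
    ((hQstr l (A l s) (hA l)).contDiff_planePressure.differentiable (by simp)) x
  have hd : HasFDerivAt (profilePotential (V 0) (V 1) (A 0) (A 1) (Q 0) (Q 1) (Q i) s)
      (fderiv ℝ (fun y => Q i s y ^ 2) x + (2 : ℝ) • (fderiv ℝ (planePressure (A 0 s • V 0) (Q 0 s)) x +
        fderiv ℝ (planePressure (A 1 s • V 1) (Q 1 s)) x)) x := by
    have := hdq.hasFDerivAt.add (((hdp 0).hasFDerivAt.add (hdp 1).hasFDerivAt).const_mul (2 : ℝ))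
    exact this
  have eR : derivR (profilePotential (V 0) (V 1) (A 0) (A 1) (Q 0) (Q 1) (Q i) s) x =
      derivR (fun y => Q i s y ^ 2) x + 2 * (derivR (planePressure (A 0 s • V 0) (Q 0 s)) x +
        derivR (planePressure (A 1 s • V 1) (Q 1 s)) x) := by
    simp only [derivR, hd.fderiv, _root_.add_apply, FunLike.coe_smul, Pi.smul_apply, smul_eq_mul]
  have eZ : derivZ (profilePotential (V 0) (V 1) (A 0) (A 1) (Q 0) (Q 1) (Q i) s) x =
      derivZ (fun y => Q i s y ^ 2) x + 2 * (derivZ (planePressure (A 0 s • V 0) (Q 0 s)) x +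
        derivZ (planePressure (A 1 s • V 1) (Q 1 s)) x) := by
    simp only [derivZ, hd.fderiv, _root_.add_apply, FunLike.coe_smul, Pi.smul_apply, smul_eq_mul]
  rw [eR, eZ, (h1 0).derivR_planePressure_smul (hA 0), (h1 1).derivR_planePressure_smul (hA 1),
    (h1 0).derivZ_planePressure_smul (hA 0), (h1 1).derivZ_planePressure_smul (hA 1)]
  ring

/-- **The link (4.16) ↔ expanded form**: at time `s`,
`Vᵢ·∇(H²ᵢ + 2p[a₀ᵏV₀,H₀] + 2p[a₁ᵏV₁,H₁])(x) = gᵢ(s,x) + a₀ᵏ(s)² f_{i,0}(s,x) + a₁ᵏ(s)² f_{i,1}(s,x)`.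
[cite: Ozanski2017NSISingular, §4.1 (4.16)–(4.17)] -/
theorem link (hQ : IsQData U V f φ ψ H T δ κ a) (k : ℕ) (i : Fin 2) (s : ℝ) (x : ℝ × ℝ) :
    (V i x).1 * derivR (profilePotential (V 0) (V 1) (a k 0) (a k 1) (H 0) (H 1) (H i) s) x +
        (V i x).2 * derivZ (profilePotential (V 0) (V 1) (a k 0) (a k 1) (H 0) (H 1) (H i) s) x =
      gFam V H i s x + a k 0 s ^ 2 * fFam V H i 0 s x + a k 1 s ^ 2 * fFam V H i 1 s x := by
  rw [inner_grad_profilePotential (ψ := ψ) s (fun l => (hQ.H_smooth l).slice_param s)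
    (fun l b hb => hQ.H_str l s b hb) (fun l => hQ.osc.abs_le k l s) i x]
  simp only [gFam, fFam]
  ring

/-! ### Compactness constants -/

/-- A continuous function positive on a compact set is bounded below there by a positive
constant. [folklore] -/
theorem exists_forall_le_of_pos {X : Type*} [TopologicalSpace X] {K : Set X} (hK : IsCompact K)
    {g : X → ℝ} (hg : ContinuousOn g K) (hpos : ∀ p ∈ K, 0 < g p) : ∃ μ > 0, ∀ p ∈ K, μ ≤ g p := by
  rcases K.eq_empty_or_nonempty with hE | hE
  · exact ⟨1, one_pos, fun p hp => by simp [hE] at hp⟩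
  · obtain ⟨p₀, hp₀, hmin⟩ := hK.exists_isMinOn hE hg
    exact ⟨g p₀, hpos p₀ hp₀, fun p hp => hmin hp⟩

/-- **The margin `H²_{i,t} ≥ |Vᵢ|² + μ` on `[0,T] × {φᵢ = 1}`** (`H_{i,t} > |Vᵢ|` on `Uᵢ`, a
compact set, continuity). [cite: Ozanski2017NSISingular, §4.1 (4.19)] -/
theorem exists_margin (hQ : IsQData U V f φ ψ H T δ κ a) :
    ∃ μ > 0, ∀ i, ∀ t ∈ Icc (0 : ℝ) T, ∀ x, φ i x = 1 →
      (V i x).1 ^ 2 + (V i x).2 ^ 2 + μ ≤ H i t x ^ 2 := by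
  have key : ∀ i, ∃ μ > 0, ∀ t ∈ Icc (0 : ℝ) T, ∀ x, φ i x = 1 →
      (V i x).1 ^ 2 + (V i x).2 ^ 2 + μ ≤ H i t x ^ 2 := by
    intro i
    have hS := hQ.isNSIStructure i
    set K : Set (ℝ × (ℝ × ℝ)) := Icc (0 : ℝ) T ×ˢ {x | φ i x = 1} with hK
    have hKc : IsCompact K := isCompact_Icc.prod (hS.isCompact_tsupport_φ.of_isClosed_subset
      (isClosed_eq hS.φ_smooth.continuous continuous_const) fun x hx => mem_tsupport_of_eq_one hx)
    set g : ℝ × (ℝ × ℝ) → ℝ := fun p => H i p.1 p.2 ^ 2 - ((V i p.2).1 ^ 2 + (V i p.2).2 ^ 2)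
    have hv : Continuous fun p : ℝ × (ℝ × ℝ) => V i p.2 := hS.v_smooth.continuous.comp continuous_snd
    have hgc : Continuous g := ((hQ.H_smooth i).continuous.pow 2).sub
      (((continuous_fst.comp hv).pow 2).add ((continuous_snd.comp hv).pow 2))
    have hpos : ∀ p ∈ K, 0 < g p := by
      rintro ⟨t, x⟩ ⟨-, hx⟩
      have hxU : x ∈ U i := hS.tsupport_φ (mem_tsupport_of_eq_one hx)
      have := (hQ.H_str_one i t).sq_lt x hxU
      simp only [g]; linarith
    obtain ⟨μ, hμ, hle⟩ := exists_forall_le_of_pos hKc hgc.continuousOn hpos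
    refine ⟨μ, hμ, fun t ht x hx => ?_⟩
    have := hle (t, x) ⟨ht, hx⟩
    simp only [g] at this; linarith
  obtain ⟨μ₀, hμ₀, h₀⟩ := key 0
  obtain ⟨μ₁, hμ₁, h₁⟩ := key 1
  refine ⟨min μ₀ μ₁, lt_min hμ₀ hμ₁, Fin.forall_fin_two.2 ⟨fun t ht x hx => ?_, fun t ht x hx => ?_⟩⟩
  · have := h₀ t ht x hx; linarith [min_le_left μ₀ μ₁]
  · have := h₁ t ht x hx; linarith [min_le_right μ₀ μ₁]

/-- A common bound `|Vᵢ,₁| + |Vᵢ,₂| ≤ B` for both planar fields. [folklore] -/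
theorem exists_abs_V_le (hQ : IsQData U V f φ ψ H T δ κ a) :
    ∃ B : ℝ, 0 ≤ B ∧ ∀ i x, |(V i x).1| + |(V i x).2| ≤ B := by
  obtain ⟨B₀, hB₀, h₀⟩ := (hQ.isNSIStructure 0).exists_abs_v_le
  obtain ⟨B₁, hB₁, h₁⟩ := (hQ.isNSIStructure 1).exists_abs_v_le
  refine ⟨max B₀ B₁, le_max_of_le_left hB₀, fun i x => ?_⟩
  fin_cases i
  · exact (h₀ x).trans (le_max_left _ _)
  · exact (h₁ x).trans (le_max_right _ _)

/-- A common constant for the first lemma of Appendix A.3 on both `Uᵢ`. [cite: Ozanski2017NSISingular, App. A.3 (first lemma)] -/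
theorem exists_pressure_constant (U : Fin 2 → Set (ℝ × ℝ)) :
    ∃ K : ℝ, 0 ≤ K ∧ ∀ i, ∀ (v : ℝ × ℝ → ℝ × ℝ) (g₁ g₂ φ₁ φ₂ : ℝ × ℝ → ℝ),
      IsNSIStructure (U i) v g₁ φ₁ → IsNSIStructure (U i) v g₂ φ₂ → ∀ (S₁ S₂ : ℝ),
      (∀ q, ‖fderiv ℝ (fun q' => g₁ q' ^ 2 - g₂ q' ^ 2) q‖ ≤ S₁) →
      (∀ q, ‖fderiv ℝ (fderiv ℝ fun q' => g₁ q' ^ 2 - g₂ q' ^ 2) q‖ ≤ S₂) → ∀ q : ℝ × ℝ,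
        |derivR (planePressure v g₁) q - derivR (planePressure v g₂) q| ≤ K * (S₁ + S₂) ∧
        |derivZ (planePressure v g₁) q - derivZ (planePressure v g₂) q| ≤ K * (S₁ + S₂) := by
  obtain ⟨K₀, hK₀, h₀⟩ := exists_planePressure_sub_le (U 0)
  obtain ⟨K₁, hK₁, h₁⟩ := exists_planePressure_sub_le (U 1)
  refine ⟨max K₀ K₁, le_max_of_le_left hK₀, fun i v g₁ g₂ φ₁ φ₂ hg₁ hg₂ S₁ S₂ hS₁ hS₂ q => ?_⟩
  have hS0 : 0 ≤ S₁ + S₂ := add_nonneg ((norm_nonneg _).trans (hS₁ q)) ((norm_nonneg _).trans (hS₂ q))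
  fin_cases i
  · have := h₀ v g₁ g₂ φ₁ φ₂ hg₁ hg₂ S₁ S₂ hS₁ hS₂ q
    exact ⟨this.1.trans (mul_le_mul_of_nonneg_right (le_max_left _ _) hS0),
      this.2.trans (mul_le_mul_of_nonneg_right (le_max_left _ _) hS0)⟩
  · have := h₁ v g₁ g₂ φ₁ φ₂ hg₁ hg₂ S₁ S₂ hS₁ hS₂ q
    exact ⟨this.1.trans (mul_le_mul_of_nonneg_right (le_max_right _ _) hS0),
      this.2.trans (mul_le_mul_of_nonneg_right (le_max_right _ _) hS0)⟩

/-! ### Uniform smallness for `k` large ((4.18), (4.22)), on the whole plane -/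

/-- Planar derivatives up to order two vanish at points of an open set where the function
vanishes identically. [folklore] -/
theorem derivs_eq_zero_of_eqOn {E : ℝ × ℝ → ℝ} {O : Set (ℝ × ℝ)} (hO : IsOpen O)
    (hE : ∀ x ∈ O, E x = 0) {x : ℝ × ℝ} (hx : x ∈ O) :
    derivR E x = 0 ∧ derivZ E x = 0 ∧ derivR (derivR E) x = 0 ∧ derivR (derivZ E) x = 0 ∧
      derivZ (derivR E) x = 0 ∧ derivZ (derivZ E) x = 0 := by
  have h0 : ∀ x' ∈ O, fderiv ℝ E x' = 0 := fun x' hx' =>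
    (fderiv_eq_zero_of_eventuallyEq_zero (Filter.eventually_of_mem (hO.mem_nhds hx') hE)).1
  have hR : ∀ x' ∈ O, derivR E x' = 0 := fun x' hx' => by simp [derivR, h0 x' hx']
  have hZ : ∀ x' ∈ O, derivZ E x' = 0 := fun x' hx' => by simp [derivZ, h0 x' hx']
  have hR0 : fderiv ℝ (derivR E) x = 0 :=
    (fderiv_eq_zero_of_eventuallyEq_zero (Filter.eventually_of_mem (hO.mem_nhds hx) hR)).1
  have hZ0 : fderiv ℝ (derivZ E) x = 0 :=
    (fderiv_eq_zero_of_eventuallyEq_zero (Filter.eventually_of_mem (hO.mem_nhds hx) hZ)).1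
  refine ⟨hR x hx, hZ x hx, ?_, ?_, ?_, ?_⟩ <;> simp [derivR, derivZ, hR0, hZ0]

/-- **Goodness of an index `k` at tolerance `ε`**: the oscillatory error of (4.16) and all its
planar derivatives of order `≤ 2` are `≤ ε` on `[0,T] × ℝ²`, for both `i`.
[cite: Ozanski2017NSISingular, §4.1 (4.18)] -/
def Good (a : ℕ → Fin 2 → ℝ → ℝ) (V : Fin 2 → ℝ × ℝ → ℝ × ℝ) (H : Fin 2 → ℝ → ℝ × ℝ → ℝ)
    (T : ℝ) (k : ℕ) (ε : ℝ) : Prop :=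
  ∀ t ∈ Icc (0 : ℝ) T, ∀ x : ℝ × ℝ, ∀ i : Fin 2,
    |oscError a (gFam V H) (fFam V H) k i t x| ≤ ε ∧
    |derivR (oscError a (gFam V H) (fFam V H) k i t) x| ≤ ε ∧
    |derivZ (oscError a (gFam V H) (fFam V H) k i t) x| ≤ ε ∧
    |derivR (derivR (oscError a (gFam V H) (fFam V H) k i t)) x| ≤ ε ∧
    |derivR (derivZ (oscError a (gFam V H) (fFam V H) k i t)) x| ≤ ε ∧
    |derivZ (derivR (oscError a (gFam V H) (fFam V H) k i t)) x| ≤ ε ∧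
    |derivZ (derivZ (oscError a (gFam V H) (fFam V H) k i t)) x| ≤ ε

/-- **(4.18) for the data: every tolerance is met for `k` large**, on the whole plane (on
`P = Ū₁ ∪ Ū₂` by `IsOscFamily.oscError_small_two`; off `P` the error vanishes identically with
its derivatives). [cite: Ozanski2017NSISingular, §4.1 (4.18) and §4.3 (4.22)] -/
theorem exists_good (hQ : IsQData U V f φ ψ H T δ κ a) {ε : ℝ} (hε : 0 < ε) :
    ∃ K : ℕ, ∀ k ≥ K, Good a V H T k ε := by
  obtain ⟨K, hK⟩ := hQ.osc.oscError_small_two hQ.isCompact_P hQ.contDiff_gFam hQ.contDiff_fFam ε hε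
  refine ⟨K, fun k hk t ht x i => ?_⟩
  by_cases hx : x ∈ closure (U 0) ∪ closure (U 1)
  · exact hK k hk x hx t ht i
  · -- off `P` the error vanishes identically near `x`
    have hO : IsOpen (closure (U 0) ∪ closure (U 1))ᶜ :=
      (isClosed_closure.union isClosed_closure).isOpen_compl
    have hE : ∀ x' ∈ (closure (U 0) ∪ closure (U 1))ᶜ,
        oscError a (gFam V H) (fFam V H) k i t x' = 0 := fun x' hx' =>
      oscError_eq_zero (hQ.V_eq_zero_of_notMem_P hx' i) k t
    obtain ⟨h1, h2, h3, h4, h5, h6⟩ := derivs_eq_zero_of_eqOn hO hE hx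
    rw [hE x hx, h1, h2, h3, h4, h5, h6, abs_zero]
    exact ⟨hε.le, hε.le, hε.le, hε.le, hε.le, hε.le, hε.le⟩

/-! ### The radicand: smoothness, time derivative, sign -/

/-- The integrand of (4.16) is jointly smooth. [cite: Ozanski2017NSISingular, §4.1 (4.16)] -/
theorem contDiff_integrand (hQ : IsQData U V f φ ψ H T δ κ a) (k : ℕ) (i : Fin 2) :
    ContDiff ℝ ∞ (uncurry fun (s : ℝ) (x : ℝ × ℝ) => a k i s *
      (gFam V H i s x + a k 0 s ^ 2 * fFam V H i 0 s x + a k 1 s ^ 2 * fFam V H i 1 s x)) :=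
  contDiff_oscIntegrand hQ.osc hQ.contDiff_gFam hQ.contDiff_fFam k i

/-- **The radicand `(qᵏ_{i,t})²(x)` is jointly smooth in `(t,x)`.**
[cite: Ozanski2017NSISingular, §4.1 ("all terms on the right-hand side of (4.16) are smooth")] -/
theorem contDiff_qRad (hQ : IsQData U V f φ ψ H T δ κ a) (k : ℕ) (i : Fin 2) :
    ContDiff ℝ ∞ (uncurry (qRad f φ δ κ a V H k i)) := by
  have hS := hQ.isNSIStructure i
  have hI := contDiff_primitive_param (hQ.contDiff_integrand k i)
  have h1 : ContDiff ℝ ∞ fun p : ℝ × (ℝ × ℝ) => f i p.2 ^ 2 - 2 * κ p.1 * δ * φ i p.2 :=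
    ((hS.f_smooth.comp contDiff_snd).pow 2).sub
      (((contDiff_const.mul (hQ.κ_smooth.comp contDiff_fst)).mul contDiff_const).mul
        (hS.φ_smooth.comp contDiff_snd))
  exact h1.sub hI

/-- **(4.17): `∂ₜ(qᵏ_{i,t})²(x) = -2δφᵢ(x) - aᵢᵏ(t)(gᵢ + (a₀ᵏ)²f_{i,0} + (a₁ᵏ)²f_{i,1})(t,x)`** for
`t ∈ [0,T]` (`κ' = 1` there). [cite: Ozanski2017NSISingular, §4.1 (4.17)] -/
theorem hasDerivAt_qRad (hQ : IsQData U V f φ ψ H T δ κ a) (k : ℕ) (i : Fin 2) {t : ℝ}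
    (ht : t ∈ Icc (0 : ℝ) T) (x : ℝ × ℝ) :
    HasDerivAt (fun s => qRad f φ δ κ a V H k i s x)
      (-(2 * δ * φ i x) - a k i t *
        (gFam V H i t x + a k 0 t ^ 2 * fFam V H i 0 t x + a k 1 t ^ 2 * fFam V H i 1 t x)) t := by
  have hκ : HasDerivAt κ 1 t := by
    have := (hQ.κ_smooth.differentiable (by simp) t).hasDerivAt
    rwa [hQ.deriv_κ_eq t ht] at this
  have h1 : HasDerivAt (fun s => f i x ^ 2 - 2 * κ s * δ * φ i x) (-(2 * δ * φ i x)) t := by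
    have h := ((hκ.const_mul 2).mul_const δ).mul_const (φ i x)
    exact (h.const_sub (f i x ^ 2)).congr_deriv (by ring)
  have h2 := hasDerivAt_primitive_param (hQ.contDiff_integrand k i) t x
  exact h1.sub h2

/-- **`(qᵏ_{i,t})² > |Vᵢ|²` on `Uᵢ` for `t ∈ [0,T]`** when `k` is good at a tolerance `ε < μ`
((4.19): on `{φᵢ = 1}` by the margin of `H` and `|(qᵏ)² - H²| ≤ ε`; on `{φᵢ < 1}` the damped
radicand is positive and `Vᵢ = 0`). [cite: Ozanski2017NSISingular, §4.1 (4.19)] -/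
theorem sq_lt_qRad_of_mem_Icc (hQ : IsQData U V f φ ψ H T δ κ a) {k : ℕ} {ε μ : ℝ}
    (hg : Good a V H T k ε)
    (hμ : ∀ i, ∀ t ∈ Icc (0 : ℝ) T, ∀ x, φ i x = 1 → (V i x).1 ^ 2 + (V i x).2 ^ 2 + μ ≤ H i t x ^ 2)
    (hεμ : ε < μ) (i : Fin 2) {t : ℝ} (ht : t ∈ Icc (0 : ℝ) T) {x : ℝ × ℝ} (hx : x ∈ U i) :
    (V i x).1 ^ 2 + (V i x).2 ^ 2 < qRad f φ δ κ a V H k i t x := by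
  have hS := hQ.isNSIStructure i
  rcases (hS.φ_mem x).2.lt_or_eq with hφ | hφ
  · rw [qRad_of_V_eq_zero (hQ.V_eq_zero_of_lt hφ), hQ.V_eq_zero_of_lt hφ]
    obtain ⟨m, hm, hgap⟩ := hQ.gap i
    simpa using hS.radicand_pos_of_gap hm (hgap (κ t) (hQ.κ_mem t)) hx
  · have h1 := hQ.qRad_sub_H_sq k i (hQ.κ_eq t ht) x
    have h2 := (abs_le.1 (hg t ht x i).1).2
    have h3 := hμ i t ht x hφ
    linarith

/-- If `(qᵏ_{i,t})² > |Vᵢ|²` on `Uᵢ` then `(qᵏ_{i,t})² ≥ 0` everywhere (off `Uᵢ` it is `fᵢ² ≥ 0`).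
[folklore] -/
theorem qRad_nonneg (hQ : IsQData U V f φ ψ H T δ κ a) (k : ℕ) (i : Fin 2) {t : ℝ}
    (ht : ∀ x ∈ U i, (V i x).1 ^ 2 + (V i x).2 ^ 2 < qRad f φ δ κ a V H k i t x) (x : ℝ × ℝ) :
    0 ≤ qRad f φ δ κ a V H k i t x := by
  by_cases hx : x ∈ U i
  · have := ht x hx; nlinarith [sq_nonneg (V i x).1, sq_nonneg (V i x).2]
  · have hS := hQ.isNSIStructure i
    have hφ : x ∉ tsupport (φ i) := fun h => hx (hS.tsupport_φ h)
    rw [qRad_of_V_eq_zero (hQ.V_eq_zero_of_notMem hφ), image_eq_zero_of_notMem_tsupport hφ,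
      mul_zero, sub_zero]
    exact sq_nonneg _

/-- An open set containing `[0,T]` contains an open interval around it. [folklore] -/
theorem exists_Ioo_subset {u : Set ℝ} (hu : IsOpen u) {T : ℝ} (hT : 0 ≤ T) (hsub : Icc 0 T ⊆ u) :
    ∃ η > 0, Ioo (-η) (T + η) ⊆ u := by
  obtain ⟨r₁, hr₁, hb₁⟩ := Metric.isOpen_iff.1 hu 0 (hsub ⟨le_rfl, hT⟩)
  obtain ⟨r₂, hr₂, hb₂⟩ := Metric.isOpen_iff.1 hu T (hsub ⟨hT, le_rfl⟩)
  refine ⟨min r₁ r₂, lt_min hr₁ hr₂, fun t ht => ?_⟩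
  rcases lt_or_ge t 0 with h0 | h0
  · apply hb₁
    rw [mem_ball, Real.dist_eq, sub_zero, abs_of_neg h0]
    linarith [ht.1, min_le_left r₁ r₂]
  · rcases le_or_gt t T with h1 | h1
    · exact hsub ⟨h0, h1⟩
    · apply hb₂
      rw [mem_ball, Real.dist_eq, abs_of_pos (by linarith)]
      linarith [ht.2, min_le_right r₁ r₂]

/-- **(4.20), "by continuity": `(qᵏ_{i,t})² > |Vᵢ|²` on `Uᵢ` for `t` in an open interval around
`[0,T]`** (the set `{(t,x) : |Vᵢ(x)|² < (qᵏ_{i,t})²(x)}` is open and contains the compact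
`[0,T] × supp φᵢ`; tube lemma; off `supp φᵢ` the radicand is `fᵢ² > 0` on `Uᵢ`).
[cite: Ozanski2017NSISingular, §4.1 (4.20)] -/
theorem exists_eta (hQ : IsQData U V f φ ψ H T δ κ a) (k : ℕ)
    (hpos : ∀ i, ∀ t ∈ Icc (0 : ℝ) T, ∀ x ∈ U i,
      (V i x).1 ^ 2 + (V i x).2 ^ 2 < qRad f φ δ κ a V H k i t x) :
    ∃ η > 0, ∀ i, ∀ t ∈ Ioo (-η) (T + η), ∀ x ∈ U i,
      (V i x).1 ^ 2 + (V i x).2 ^ 2 < qRad f φ δ κ a V H k i t x := by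
  have key : ∀ i, ∃ η > 0, ∀ t ∈ Ioo (-η) (T + η), ∀ x ∈ U i,
      (V i x).1 ^ 2 + (V i x).2 ^ 2 < qRad f φ δ κ a V H k i t x := by
    intro i
    have hS := hQ.isNSIStructure i
    set O : Set (ℝ × (ℝ × ℝ)) :=
      {p | (V i p.2).1 ^ 2 + (V i p.2).2 ^ 2 < qRad f φ δ κ a V H k i p.1 p.2} with hO
    have hv : Continuous fun p : ℝ × (ℝ × ℝ) => V i p.2 := hS.v_smooth.continuous.comp continuous_snd
    have hOo : IsOpen O := isOpen_lt (((continuous_fst.comp hv).pow 2).add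
      ((continuous_snd.comp hv).pow 2)) (hQ.contDiff_qRad k i).continuous
    have hsub : Icc (0 : ℝ) T ×ˢ tsupport (φ i) ⊆ O := by
      rintro ⟨t, x⟩ ⟨ht, hx⟩
      exact hpos i t ht x (hS.tsupport_φ hx)
    obtain ⟨u, w, hu, -, hIu, hKw, huw⟩ :=
      generalized_tube_lemma isCompact_Icc hS.isCompact_tsupport_φ hOo hsub
    obtain ⟨η, hη, hηu⟩ := exists_Ioo_subset hu hQ.T_pos.le hIu
    refine ⟨η, hη, fun t ht x hx => ?_⟩
    by_cases hxφ : x ∈ tsupport (φ i)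
    · have hmem := huw (mk_mem_prod (hηu ht) (hKw hxφ))
      exact hmem
    · rw [qRad_of_V_eq_zero (hQ.V_eq_zero_of_notMem hxφ), hQ.V_eq_zero_of_notMem hxφ,
        image_eq_zero_of_notMem_tsupport hxφ, mul_zero, sub_zero]
      simpa using pow_pos (hS.f_pos hx) 2
  obtain ⟨η₀, hη₀, h₀⟩ := key 0
  obtain ⟨η₁, hη₁, h₁⟩ := key 1
  refine ⟨min η₀ η₁, lt_min hη₀ hη₁, fun i t ht x hx => ?_⟩
  fin_cases i
  · exact h₀ t ⟨by linarith [ht.1, min_le_left η₀ η₁], by linarith [ht.2, min_le_left η₀ η₁]⟩ x hx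
  · exact h₁ t ⟨by linarith [ht.1, min_le_right η₀ η₁], by linarith [ht.2, min_le_right η₀ η₁]⟩ x hx

/-! ### The profile `qᵏ`: values, smoothness, squares -/

/-- `qᵏ_{i,t} ≥ 0`. [cite: Ozanski2017NSISingular, §4.1 (4.16)] -/
theorem qProf_nonneg (k : ℕ) (i : Fin 2) (t : ℝ) (x : ℝ × ℝ) : 0 ≤ qProf f φ δ κ a V H k i t x :=
  Real.sqrt_nonneg _

/-- **`qᵏ_{i,0} = fᵢ`** (Ożański §4.2: `qᵏ_{i,0} = fᵢ`, giving `|u(x,0)| = h₀(R⁻¹x)`).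
[cite: Ozanski2017NSISingular, Prop. 4.2 (ii) and §4.2] -/
theorem qProf_zero (hQ : IsQData U V f φ ψ H T δ κ a) (k : ℕ) (i : Fin 2) (x : ℝ × ℝ) :
    qProf f φ δ κ a V H k i 0 x = f i x := by
  have h0 : κ 0 = 0 := hQ.κ_eq 0 ⟨le_rfl, hQ.T_pos.le⟩
  rw [qProf, qRad, h0, oscIntegral, intervalIntegral.integral_same]
  simp [Real.sqrt_sq ((hQ.isNSIStructure i).f_nonneg x)]

/-- **`qᵏ_{i,t} = 0` off `Ūᵢ`** (all data vanish there). [cite: Ozanski2017NSISingular, Prop. 4.2 (i)] -/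
theorem qProf_eq_zero (hQ : IsQData U V f φ ψ H T δ κ a) (k : ℕ) (i : Fin 2) (t : ℝ) {x : ℝ × ℝ}
    (hx : x ∉ closure (U i)) : qProf f φ δ κ a V H k i t x = 0 := by
  have hS := hQ.isNSIStructure i
  have hφ : x ∉ tsupport (φ i) := fun h => hx (subset_closure (hS.tsupport_φ h))
  rw [qProf, qRad_of_V_eq_zero (hQ.V_eq_zero_of_notMem hφ), image_eq_zero_of_notMem_tsupport hφ,
    hS.f_eq_zero hx]
  simp

/-- **On `{φᵢ < 1}`, `qᵏ_{i,t}` is the damped profile `√(fᵢ² - 2κ(t)δφᵢ)`** (`Vᵢ = 0` there).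
[cite: Ozanski2017NSISingular, §4.1 ("`qᵏ_{i,t}` differs from `fᵢ` only on `supp φᵢ`")] -/
theorem qProf_eq_dampedProfile (hQ : IsQData U V f φ ψ H T δ κ a) (k : ℕ) (i : Fin 2) (t : ℝ)
    {x : ℝ × ℝ} (hx : φ i x < 1) : qProf f φ δ κ a V H k i t x = dampedProfile (f i) (φ i) δ (κ t) x := by
  rw [qProf, qRad_of_V_eq_zero (hQ.V_eq_zero_of_lt hx), dampedProfile_apply]

/-- `qᵏ_{i,t} = fᵢ` off `supp φᵢ`. [cite: Ozanski2017NSISingular, §4.1] -/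
theorem qProf_eq_of_notMem (hQ : IsQData U V f φ ψ H T δ κ a) (k : ℕ) (i : Fin 2) (t : ℝ)
    {x : ℝ × ℝ} (hx : x ∉ tsupport (φ i)) : qProf f φ δ κ a V H k i t x = f i x := by
  rw [hQ.qProf_eq_dampedProfile k i t (by rw [image_eq_zero_of_notMem_tsupport hx]; norm_num),
    (hQ.isNSIStructure i).dampedProfile_eq_of_notMem δ _ hx]

/-- **`qᵏᵢ` is jointly smooth on `S × ℝ²`** whenever `(qᵏ_{i,t})² > |Vᵢ|²` on `Uᵢ` for `t ∈ S`, `S`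
open (square root of a positive smooth function near points of `supp φᵢ`, `= fᵢ` near the other
points). [cite: Ozanski2017NSISingular, Prop. 4.2 (smoothness of `u`) and §4.2] -/
theorem contDiffOn_qProf (hQ : IsQData U V f φ ψ H T δ κ a) (k : ℕ) (i : Fin 2) {S : Set ℝ}
    (hpos : ∀ t ∈ S, ∀ x ∈ U i, (V i x).1 ^ 2 + (V i x).2 ^ 2 < qRad f φ δ κ a V H k i t x) :
    ContDiffOn ℝ ∞ (uncurry (qProf f φ δ κ a V H k i)) (S ×ˢ (univ : Set (ℝ × ℝ))) := by
  have hSi := hQ.isNSIStructure i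
  rintro ⟨t, x⟩ ⟨ht, -⟩
  by_cases hx : x ∈ tsupport (φ i)
  · have hp : 0 < qRad f φ δ κ a V H k i t x := by
      have := hpos t ht x (hSi.tsupport_φ hx)
      nlinarith [sq_nonneg (V i x).1, sq_nonneg (V i x).2]
    have hp' : uncurry (qRad f φ δ κ a V H k i) (t, x) ≠ 0 := hp.ne'
    exact ((hQ.contDiff_qRad k i).contDiffAt.sqrt hp').contDiffWithinAt
  · have hO : IsOpen ((univ : Set ℝ) ×ˢ (tsupport (φ i))ᶜ) :=
      isOpen_univ.prod (isClosed_tsupport _).isOpen_compl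
    have hev : uncurry (qProf f φ δ κ a V H k i) =ᶠ[𝓝 (t, x)] fun p : ℝ × (ℝ × ℝ) => f i p.2 :=
      Filter.eventually_of_mem (hO.mem_nhds ⟨mem_univ _, hx⟩) fun p hp =>
        hQ.qProf_eq_of_notMem k i p.1 hp.2
    exact ((hSi.f_smooth.comp contDiff_snd).contDiffAt.congr_of_eventuallyEq hev).contDiffWithinAt

/-- `(qᵏ_{i,t})² = qRad` wherever the radicand is nonnegative. [folklore] -/
theorem qProf_sq {k : ℕ} {i : Fin 2} {t : ℝ} {x : ℝ × ℝ} (h : 0 ≤ qRad f φ δ κ a V H k i t x) :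
    qProf f φ δ κ a V H k i t x ^ 2 = qRad f φ δ κ a V H k i t x := by
  rw [qProf, Real.sq_sqrt h]

/-- **`(bVᵢ, qᵏ_{i,t}, ψᵢ)` is a structure on `Uᵢ`** for `t ∈ [0,T]`, `|b| ≤ 1` ((4.20)), and
`L(qᵏ_{i,t}) ≥ 0` on `{φᵢ < 1/4}`, by the perturbation criterion.
[cite: Ozanski2017NSISingular, §4.1 (4.20)] -/
theorem crit_qProf (hQ : IsQData U V f φ ψ H T δ κ a) {k : ℕ} (i : Fin 2) {S : Set ℝ}
    (hposS : ∀ t ∈ S, ∀ x ∈ U i, (V i x).1 ^ 2 + (V i x).2 ^ 2 < qRad f φ δ κ a V H k i t x)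
    {t : ℝ} (ht : t ∈ S) (htT : κ t ∈ Icc (-1 : ℝ) (T + 1)) :
    (∀ b : ℝ, |b| ≤ 1 → IsNSIStructure (U i) (b • V i) (qProf f φ δ κ a V H k i t) (ψ i)) ∧
      (∀ x, φ i x < 1 / 4 → 0 ≤ opL (qProf f φ δ κ a V H k i t) x) ∧
      (∀ x ∈ tsupport (φ i), φ i x ≤ 1 / 4 → 0 < opL (qProf f φ δ κ a V H k i t) x) ∧
      (∀ x ∈ U i, 0 < qProf f φ δ κ a V H k i t x) ∧
      (∀ x ∉ closure (U i), qProf f φ δ κ a V H k i t x = 0) ∧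
      (∀ x ∉ tsupport (φ i), qProf f φ δ κ a V H k i t x = f i x) :=
  hQ.crit i (κ t) htT _
    (IsSmoothSpaceTimeOn.contDiff_slice (w := qProf f φ δ κ a V H k i)
      (hQ.contDiffOn_qProf k i hposS) ht)
    (qProf_nonneg k i t) (fun _ hx => hQ.qProf_eq_dampedProfile k i t hx) fun x hx => by
      rw [qProf_sq (hQ.qRad_nonneg k i (hposS t ht) x)]
      exact hposS t ht x ((hQ.isNSIStructure i).tsupport_φ (mem_tsupport_of_eq_one hx))

/-! ### The first lemma of Appendix A.3 applied to `(w, qᵏ_{l,t})`, `(w, h_{l,t})` ((4.27)) -/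

/-- **`(qᵏ_{l,t})² - h²_{l,t} = -oscError` as functions of `x`**, for `t ∈ [0,T]` with the
radicand nonnegative. [cite: Ozanski2017NSISingular, §4.1 (4.16) and (4.9)] -/
theorem qProf_sq_sub_H_sq (hQ : IsQData U V f φ ψ H T δ κ a) (k : ℕ) (l : Fin 2) {t : ℝ}
    (ht : t ∈ Icc (0 : ℝ) T)
    (hpos : ∀ x ∈ U l, (V l x).1 ^ 2 + (V l x).2 ^ 2 < qRad f φ δ κ a V H k l t x) :
    (fun y => qProf f φ δ κ a V H k l t y ^ 2 - H l t y ^ 2) =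
      -(oscError a (gFam V H) (fFam V H) k l t) := by
  funext y
  rw [qProf_sq (hQ.qRad_nonneg k l hpos y), Pi.neg_apply, ← hQ.qRad_sub_H_sq k l (hQ.κ_eq t ht) y]

/-- **The `C¹`/`C²` sizes `S₁ = 2ε`, `S₂ = 4ε` of `(qᵏ_{l,t})² - h²_{l,t}`** for a good `k`
((4.23)/(4.18) fed into the continuity lemma). [cite: Ozanski2017NSISingular, §4.2 (4.27) and §4.1 (4.18)] -/
theorem norm_fderiv_sq_sub_le (hQ : IsQData U V f φ ψ H T δ κ a) {k : ℕ} {ε : ℝ}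
    (hg : Good a V H T k ε) (l : Fin 2) {t : ℝ} (ht : t ∈ Icc (0 : ℝ) T)
    (hpos : ∀ x ∈ U l, (V l x).1 ^ 2 + (V l x).2 ^ 2 < qRad f φ δ κ a V H k l t x) :
    (∀ y, ‖fderiv ℝ (fun y' => qProf f φ δ κ a V H k l t y' ^ 2 - H l t y' ^ 2) y‖ ≤ 2 * ε) ∧
      ∀ y, ‖fderiv ℝ (fderiv ℝ fun y' => qProf f φ δ κ a V H k l t y' ^ 2 - H l t y' ^ 2) y‖ ≤ 4 * ε := by
  set E := oscError a (gFam V H) (fFam V H) k l t with hE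
  have e := hQ.qProf_sq_sub_H_sq k l ht hpos
  have hD : fderiv ℝ (-E) = -fderiv ℝ E := by
    funext y; exact fderiv_neg
  have hE2 : ContDiff ℝ 2 E :=
    contDiff_infty.1 (contDiff_oscError hQ.osc hQ.contDiff_gFam hQ.contDiff_fFam k l t) 2
  refine ⟨fun y => ?_, fun y => ?_⟩
  · rw [e, hD, Pi.neg_apply, norm_neg]
    have h := norm_fderiv_le_abs_add E y
    have h1 := (hg t ht y l).2.1
    have h2 := (hg t ht y l).2.2.1
    linarith
  · rw [e, hD]
    have : fderiv ℝ (-fderiv ℝ E) y = -fderiv ℝ (fderiv ℝ E) y := fderiv_neg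
    rw [this, norm_neg]
    have h := norm_fderiv_fderiv_le hE2 y
    obtain ⟨-, -, -, h3, h4, h5, h6⟩ := hg t ht y l
    linarith

/-- **`|∇p[w, qᵏ_{l,t}] - ∇p[w, h_{l,t}]| ≤ 6Kε`** componentwise, for `w ∈ {V_l, 0}` (the first lemma
of Appendix A.3 with `S₁ + S₂ = 6ε`; Ożański (4.27): "for sufficiently large `k`").
[cite: Ozanski2017NSISingular, §4.2 (4.27) and App. A.3 (first lemma)] -/
theorem abs_grad_planePressure_sub_le (hQ : IsQData U V f φ ψ H T δ κ a) {k : ℕ} {ε : ℝ}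
    (hg : Good a V H T k ε) {K : ℝ}
    (hK : ∀ i, ∀ (v : ℝ × ℝ → ℝ × ℝ) (g₁ g₂ φ₁ φ₂ : ℝ × ℝ → ℝ),
      IsNSIStructure (U i) v g₁ φ₁ → IsNSIStructure (U i) v g₂ φ₂ → ∀ (S₁ S₂ : ℝ),
      (∀ q, ‖fderiv ℝ (fun q' => g₁ q' ^ 2 - g₂ q' ^ 2) q‖ ≤ S₁) →
      (∀ q, ‖fderiv ℝ (fderiv ℝ fun q' => g₁ q' ^ 2 - g₂ q' ^ 2) q‖ ≤ S₂) → ∀ q : ℝ × ℝ,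
        |derivR (planePressure v g₁) q - derivR (planePressure v g₂) q| ≤ K * (S₁ + S₂) ∧
        |derivZ (planePressure v g₁) q - derivZ (planePressure v g₂) q| ≤ K * (S₁ + S₂))
    (l : Fin 2) {t : ℝ} (ht : t ∈ Icc (0 : ℝ) T)
    (hpos : ∀ x ∈ U l, (V l x).1 ^ 2 + (V l x).2 ^ 2 < qRad f φ δ κ a V H k l t x)
    {w : ℝ × ℝ → ℝ × ℝ} {χ₁ χ₂ : ℝ × ℝ → ℝ}
    (h1 : IsNSIStructure (U l) w (qProf f φ δ κ a V H k l t) χ₁) (h2 : IsNSIStructure (U l) w (H l t) χ₂)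
    (x : ℝ × ℝ) :
    |derivR (planePressure w (qProf f φ δ κ a V H k l t)) x - derivR (planePressure w (H l t)) x| ≤
        K * (6 * ε) ∧
      |derivZ (planePressure w (qProf f φ δ κ a V H k l t)) x - derivZ (planePressure w (H l t)) x| ≤
        K * (6 * ε) := by
  obtain ⟨hS₁, hS₂⟩ := hQ.norm_fderiv_sq_sub_le hg l ht hpos
  have := hK l w _ _ χ₁ χ₂ h1 h2 (2 * ε) (4 * ε) hS₁ hS₂ x
  have e : K * (2 * ε + 4 * ε) = K * (6 * ε) := by ring
  rw [e] at this
  exact this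

/-! ### The inner inequality on `Cᵢ` (Scheffer (2.6); Ożański §4.2, Case 2) -/

/-- `|v₁ p + v₂ q| ≤ (|v₁| + |v₂|) c` when `|p|, |q| ≤ c`. [folklore] -/
theorem abs_comb_le {v1 v2 p q c : ℝ} (hp : |p| ≤ c) (hq : |q| ≤ c) :
    |v1 * p + v2 * q| ≤ (|v1| + |v2|) * c := by
  calc |v1 * p + v2 * q| ≤ |v1 * p| + |v2 * q| := abs_add_le _ _
    _ = |v1| * |p| + |v2| * |q| := by rw [abs_mul, abs_mul]
    _ ≤ |v1| * c + |v2| * c := add_le_add (mul_le_mul_of_nonneg_left hp (abs_nonneg _))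
        (mul_le_mul_of_nonneg_left hq (abs_nonneg _))
    _ = (|v1| + |v2|) * c := by ring

/-- `|b² d| ≤ c` when `|d| ≤ c` and `b² ≤ 1`. [folklore] -/
theorem abs_sq_mul_le {b d c : ℝ} (hb : b ^ 2 ≤ 1) (hd : |d| ≤ c) : |b ^ 2 * d| ≤ c := by
  rw [abs_mul, abs_of_nonneg (sq_nonneg b)]
  calc b ^ 2 * |d| ≤ 1 * |d| := mul_le_mul_of_nonneg_right hb (abs_nonneg _)
    _ ≤ c := by rw [one_mul]; exact hd

/-- Regrouping of the difference of the two expanded transport pairings (pure algebra).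
[folklore] -/
theorem transport_diff_identity (v1 v2 q1 q1' q2 q2' r0 r0' z0 z0' r1 r1' z1 z1'
    F10 F10' F20 F20' F11 F11' F21 F21' a0 a1 : ℝ) :
    (v1 * q1 + v2 * q2 + 2 * ((v1 * r0 + v2 * z0 - a0 * (v1 * F10 + v2 * F20)) +
        (v1 * r1 + v2 * z1 - a1 * (v1 * F11 + v2 * F21)))) -
      (v1 * q1' + v2 * q2' + 2 * ((v1 * r0' + v2 * z0' - a0 * (v1 * F10' + v2 * F20')) +
        (v1 * r1' + v2 * z1' - a1 * (v1 * F11' + v2 * F21')))) =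
      (v1 * (q1 - q1') + v2 * (q2 - q2')) +
        2 * ((v1 * (r0 - r0') + v2 * (z0 - z0')) - (v1 * (a0 * (F10 - F10')) + v2 * (a0 * (F20 - F20'))) +
          ((v1 * (r1 - r1') + v2 * (z1 - z1')) - (v1 * (a1 * (F11 - F11')) + v2 * (a1 * (F21 - F21'))))) := by
  ring

/-- The bookkeeping of the transport error: triangle inequality and the five partial bounds.
[folklore] -/
theorem abs_transport_total_le {A B0 C0 B1 C1 W ε K : ℝ} (hA : |A| ≤ W * ε)
    (hB0 : |B0| ≤ W * (K * (6 * ε))) (hC0 : |C0| ≤ W * (K * (6 * ε) + K * (6 * ε)))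
    (hB1 : |B1| ≤ W * (K * (6 * ε))) (hC1 : |C1| ≤ W * (K * (6 * ε) + K * (6 * ε))) :
    |A + 2 * ((B0 - C0) + (B1 - C1))| ≤ W * ((1 + 72 * K) * ε) := by
  have h1 : |A + 2 * ((B0 - C0) + (B1 - C1))| ≤ |A| + 2 * ((|B0| + |C0|) + (|B1| + |C1|)) := by
    refine (abs_add_le _ _).trans (add_le_add le_rfl ?_)
    rw [abs_mul, abs_two]
    exact mul_le_mul_of_nonneg_left
      ((abs_add_le _ _).trans (add_le_add (abs_sub _ _) (abs_sub _ _))) (by norm_num)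
  refine h1.trans ?_
  have h2 := add_le_add hA (mul_le_mul_of_nonneg_left
    (add_le_add (add_le_add hB0 hC0) (add_le_add hB1 hC1)) (by norm_num : (0 : ℝ) ≤ 2))
  refine h2.trans (le_of_eq ?_)
  ring

/-- **The transport error `|vᵢ·∇(Ψ^q - Ψ^h)| ≤ B(1 + 72K)ε` at good `k`** ((4.27): the
difference of the planar potentials built on `qᵏ` and on `h` is `C¹`-small).
[cite: Ozanski2017NSISingular, §4.2 (4.27)] -/
theorem abs_inner_error_le (hQ : IsQData U V f φ ψ H T δ κ a) {k : ℕ} {ε : ℝ}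
    (hg : Good a V H T k ε) (hε : 0 ≤ ε) {K : ℝ} (hK0 : 0 ≤ K)
    (hK : ∀ i, ∀ (v : ℝ × ℝ → ℝ × ℝ) (g₁ g₂ φ₁ φ₂ : ℝ × ℝ → ℝ),
      IsNSIStructure (U i) v g₁ φ₁ → IsNSIStructure (U i) v g₂ φ₂ → ∀ (S₁ S₂ : ℝ),
      (∀ q, ‖fderiv ℝ (fun q' => g₁ q' ^ 2 - g₂ q' ^ 2) q‖ ≤ S₁) →
      (∀ q, ‖fderiv ℝ (fderiv ℝ fun q' => g₁ q' ^ 2 - g₂ q' ^ 2) q‖ ≤ S₂) → ∀ q : ℝ × ℝ,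
        |derivR (planePressure v g₁) q - derivR (planePressure v g₂) q| ≤ K * (S₁ + S₂) ∧
        |derivZ (planePressure v g₁) q - derivZ (planePressure v g₂) q| ≤ K * (S₁ + S₂))
    {B : ℝ} (hB : ∀ i x, |(V i x).1| + |(V i x).2| ≤ B) {S : Set ℝ}
    (hposS : ∀ i, ∀ t ∈ S, ∀ x ∈ U i, (V i x).1 ^ 2 + (V i x).2 ^ 2 < qRad f φ δ κ a V H k i t x)
    (i : Fin 2) {t : ℝ} (htS : t ∈ S) (ht : t ∈ Icc (0 : ℝ) T) (x : ℝ × ℝ) :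
    |((V i x).1 * derivR (profilePotential (V 0) (V 1) (a k 0) (a k 1)
          (qProf f φ δ κ a V H k 0) (qProf f φ δ κ a V H k 1) (qProf f φ δ κ a V H k i) t) x +
        (V i x).2 * derivZ (profilePotential (V 0) (V 1) (a k 0) (a k 1)
          (qProf f φ δ κ a V H k 0) (qProf f φ δ κ a V H k 1) (qProf f φ δ κ a V H k i) t) x) -
      ((V i x).1 * derivR (profilePotential (V 0) (V 1) (a k 0) (a k 1) (H 0) (H 1) (H i) t) x +
        (V i x).2 * derivZ (profilePotential (V 0) (V 1) (a k 0) (a k 1) (H 0) (H 1) (H i) t) x)| ≤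
      B * (1 + 72 * K) * ε := by
  have hκt : κ t ∈ Icc (-1 : ℝ) (T + 1) := by
    rw [hQ.κ_eq t ht]; exact ⟨by linarith [ht.1], by linarith [ht.2]⟩
  -- structures at time `t`
  have hcrit := fun l => hQ.crit_qProf (k := k) l (hposS l) htS hκt
  have hQstr : ∀ l, ∀ b : ℝ, |b| ≤ 1 →
      IsNSIStructure (U l) (b • V l) (qProf f φ δ κ a V H k l t) (ψ l) := fun l => (hcrit l).1
  have hQ1 : ∀ l, IsNSIStructure (U l) (V l) (qProf f φ δ κ a V H k l t) (ψ l) := fun l => by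
    simpa using hQstr l 1 (by norm_num)
  have hQ0 : ∀ l, IsNSIStructure (U l) 0 (qProf f φ δ κ a V H k l t) (ψ l) := fun l => by
    simpa using hQstr l 0 (by norm_num)
  have hposT : ∀ l, ∀ x ∈ U l, (V l x).1 ^ 2 + (V l x).2 ^ 2 < qRad f φ δ κ a V H k l t x :=
    fun l => hposS l t htS
  -- the two expansions
  have eQ := inner_grad_profilePotential (U := U) (ψ := ψ)
    (Q := qProf f φ δ κ a V H k) (A := a k) t (fun l => (hQ1 l).f_smooth) hQstr
    (fun l => hQ.osc.abs_le k l t) i x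
  have eH := inner_grad_profilePotential (U := U) (ψ := ψ) (Q := H) (A := a k) t
    (fun l => (hQ.H_smooth l).slice_param t) (fun l b hb => hQ.H_str l t b hb)
    (fun l => hQ.osc.abs_le k l t) i x
  -- the atomic differences and their bounds
  have hd1 : DifferentiableAt ℝ (fun y => qProf f φ δ κ a V H k i t y ^ 2) x :=
    (((hQ1 i).f_smooth.pow 2).differentiable (by simp)) x
  have hd2 : DifferentiableAt ℝ (fun y => H i t y ^ 2) x :=
    ((((hQ.H_smooth i).slice_param t).pow 2).differentiable (by simp)) x
  have hsub : fderiv ℝ (fun y => qProf f φ δ κ a V H k i t y ^ 2 - H i t y ^ 2) x =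
      fderiv ℝ (fun y => qProf f φ δ κ a V H k i t y ^ 2) x - fderiv ℝ (fun y => H i t y ^ 2) x :=
    (hd1.hasFDerivAt.sub hd2.hasFDerivAt).fderiv
  have esub := hQ.qProf_sq_sub_H_sq k i ht (hposT i)
  have hnegR : ∀ e : ℝ × ℝ, fderiv ℝ (-oscError a (gFam V H) (fFam V H) k i t) x e =
      -(fderiv ℝ (oscError a (gFam V H) (fFam V H) k i t) x e) := fun e => by
    rw [fderiv_neg]; rfl
  have hDR : |derivR (fun y => qProf f φ δ κ a V H k i t y ^ 2) x - derivR (fun y => H i t y ^ 2) x| ≤ ε := by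
    have e : derivR (fun y => qProf f φ δ κ a V H k i t y ^ 2) x - derivR (fun y => H i t y ^ 2) x =
        derivR (fun y => qProf f φ δ κ a V H k i t y ^ 2 - H i t y ^ 2) x := by
      simp only [derivR, hsub]; rfl
    rw [e, esub, derivR, hnegR, abs_neg]
    exact (hg t ht x i).2.1
  have hDZ : |derivZ (fun y => qProf f φ δ κ a V H k i t y ^ 2) x - derivZ (fun y => H i t y ^ 2) x| ≤ ε := by
    have e : derivZ (fun y => qProf f φ δ κ a V H k i t y ^ 2) x - derivZ (fun y => H i t y ^ 2) x =
        derivZ (fun y => qProf f φ δ κ a V H k i t y ^ 2 - H i t y ^ 2) x := by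
      simp only [derivZ, hsub]; rfl
    rw [e, esub, derivZ, hnegR, abs_neg]
    exact (hg t ht x i).2.2.1
  have hP0 := fun l => hQ.abs_grad_planePressure_sub_le hg hK l ht (hposT l) (hQ0 l) (hQ.H_str_zero l t) x
  have hP1 := fun l => hQ.abs_grad_planePressure_sub_le hg hK l ht (hposT l) (hQ1 l) (hQ.H_str_one l t) x
  -- `F = ∇p[0,·] - ∇p[V_l,·]`: differences of `F` are controlled by both
  have hF : ∀ l, |(pressureInteraction (V l) (qProf f φ δ κ a V H k l t) x).1 -
        (pressureInteraction (V l) (H l t) x).1| ≤ K * (6 * ε) + K * (6 * ε) ∧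
      |(pressureInteraction (V l) (qProf f φ δ κ a V H k l t) x).2 -
        (pressureInteraction (V l) (H l t) x).2| ≤ K * (6 * ε) + K * (6 * ε) := by
    intro l
    simp only [pressureInteraction]
    constructor
    · calc |derivR (planePressure 0 (qProf f φ δ κ a V H k l t)) x -
              derivR (planePressure (V l) (qProf f φ δ κ a V H k l t)) x -
            (derivR (planePressure 0 (H l t)) x - derivR (planePressure (V l) (H l t)) x)|
          = |(derivR (planePressure 0 (qProf f φ δ κ a V H k l t)) x - derivR (planePressure 0 (H l t)) x) -
              (derivR (planePressure (V l) (qProf f φ δ κ a V H k l t)) x -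
                derivR (planePressure (V l) (H l t)) x)| := by ring_nf
        _ ≤ _ := abs_sub _ _
        _ ≤ K * (6 * ε) + K * (6 * ε) := add_le_add (hP0 l).1 (hP1 l).1
    · calc |derivZ (planePressure 0 (qProf f φ δ κ a V H k l t)) x -
              derivZ (planePressure (V l) (qProf f φ δ κ a V H k l t)) x -
            (derivZ (planePressure 0 (H l t)) x - derivZ (planePressure (V l) (H l t)) x)|
          = |(derivZ (planePressure 0 (qProf f φ δ κ a V H k l t)) x - derivZ (planePressure 0 (H l t)) x) -
              (derivZ (planePressure (V l) (qProf f φ δ κ a V H k l t)) x -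
                derivZ (planePressure (V l) (H l t)) x)| := by ring_nf
        _ ≤ _ := abs_sub _ _
        _ ≤ K * (6 * ε) + K * (6 * ε) := add_le_add (hP0 l).2 (hP1 l).2
  -- assemble
  have hv : |(V i x).1| + |(V i x).2| ≤ B := hB i x
  have ha2 : ∀ l, a k l t ^ 2 ≤ 1 := fun l => hQ.osc.sq_le k l t
  rw [eQ, eH, transport_diff_identity]
  have b1 := abs_comb_le (v1 := (V i x).1) (v2 := (V i x).2) hDR hDZ
  have b20 := abs_comb_le (v1 := (V i x).1) (v2 := (V i x).2) (hP0 0).1 (hP0 0).2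
  have b21 := abs_comb_le (v1 := (V i x).1) (v2 := (V i x).2) (hP0 1).1 (hP0 1).2
  have b30 := abs_comb_le (v1 := (V i x).1) (v2 := (V i x).2)
    (abs_sq_mul_le (ha2 0) (hF 0).1) (abs_sq_mul_le (ha2 0) (hF 0).2)
  have b31 := abs_comb_le (v1 := (V i x).1) (v2 := (V i x).2)
    (abs_sq_mul_le (ha2 1) (hF 1).1) (abs_sq_mul_le (ha2 1) (hF 1).2)
  refine (abs_transport_total_le b1 b20 b30 b21 b31).trans ?_
  calc (|(V i x).1| + |(V i x).2|) * ((1 + 72 * K) * ε) ≤ B * ((1 + 72 * K) * ε) :=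
        mul_le_mul_of_nonneg_right hv (by positivity)
    _ = B * (1 + 72 * K) * ε := by ring

/-- **The time derivative of `(qᵏ_{i,·})²(x)` at `t ∈ [0,T]`** equals that of the radicand
((4.17)), the radicand being nonnegative for times near `t`.
[cite: Ozanski2017NSISingular, §4.1 (4.17)] -/
theorem deriv_qProf_sq (hQ : IsQData U V f φ ψ H T δ κ a) {k : ℕ} {η : ℝ}
    (hposS : ∀ i, ∀ t ∈ Ioo (-η) (T + η), ∀ x ∈ U i,
      (V i x).1 ^ 2 + (V i x).2 ^ 2 < qRad f φ δ κ a V H k i t x)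
    (hηI : Icc (0 : ℝ) T ⊆ Ioo (-η) (T + η))
    (i : Fin 2) {t : ℝ} (ht : t ∈ Icc (0 : ℝ) T) (x : ℝ × ℝ) :
    deriv (fun s => qProf f φ δ κ a V H k i s x ^ 2) t =
      -(2 * δ * φ i x) - a k i t *
        (gFam V H i t x + a k 0 t ^ 2 * fFam V H i 0 t x + a k 1 t ^ 2 * fFam V H i 1 t x) := by
  have hmem : Ioo (-η) (T + η) ∈ 𝓝 t := isOpen_Ioo.mem_nhds (hηI ht)
  have hev : (fun s => qProf f φ δ κ a V H k i s x ^ 2) =ᶠ[𝓝 t] fun s => qRad f φ δ κ a V H k i s x :=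
    Filter.eventually_of_mem hmem fun s hs => qProf_sq (hQ.qRad_nonneg k i (hposS i s hs) x)
  rw [hev.deriv_eq, (hQ.hasDerivAt_qRad k i ht x).deriv]

/-- **The inner inequality on `Cᵢ = {φᵢ ≥ 1/4}` with slack `δ/4`** (Scheffer (2.6); Ożański §4.2,
Case 2: `∂ₜ(qᵏᵢ)² = -2δφᵢ - aᵢᵏvᵢ·∇Ψ^h ≤ -δ/2 + |vᵢ·∇(Ψ^q - Ψ^h)| - aᵢᵏvᵢ·∇Ψ^q`, and (4.27)
makes the error `≤ δ/4`). [cite: Ozanski2017NSISingular, §4.2 (Case 2, (4.26)–(4.27))] [cite: Scheffer1985, Lemma 2.1 (2.6)] -/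
theorem inner_ineq (hQ : IsQData U V f φ ψ H T δ κ a) {k : ℕ} {ε : ℝ} (hg : Good a V H T k ε)
    (hε : 0 ≤ ε) {K : ℝ} (hK0 : 0 ≤ K)
    (hK : ∀ i, ∀ (v : ℝ × ℝ → ℝ × ℝ) (g₁ g₂ φ₁ φ₂ : ℝ × ℝ → ℝ),
      IsNSIStructure (U i) v g₁ φ₁ → IsNSIStructure (U i) v g₂ φ₂ → ∀ (S₁ S₂ : ℝ),
      (∀ q, ‖fderiv ℝ (fun q' => g₁ q' ^ 2 - g₂ q' ^ 2) q‖ ≤ S₁) →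
      (∀ q, ‖fderiv ℝ (fderiv ℝ fun q' => g₁ q' ^ 2 - g₂ q' ^ 2) q‖ ≤ S₂) → ∀ q : ℝ × ℝ,
        |derivR (planePressure v g₁) q - derivR (planePressure v g₂) q| ≤ K * (S₁ + S₂) ∧
        |derivZ (planePressure v g₁) q - derivZ (planePressure v g₂) q| ≤ K * (S₁ + S₂))
    {B : ℝ} (hB : ∀ i x, |(V i x).1| + |(V i x).2| ≤ B) (hεδ : B * (1 + 72 * K) * ε ≤ δ / 4)
    {η : ℝ}
    (hposS : ∀ i, ∀ t ∈ Ioo (-η) (T + η), ∀ x ∈ U i,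
      (V i x).1 ^ 2 + (V i x).2 ^ 2 < qRad f φ δ κ a V H k i t x)
    (hηI : Icc (0 : ℝ) T ⊆ Ioo (-η) (T + η))
    (i : Fin 2) {t : ℝ} (ht : t ∈ Icc (0 : ℝ) T) {x : ℝ × ℝ} (hx : 1 / 4 ≤ φ i x) :
    deriv (fun s => qProf f φ δ κ a V H k i s x ^ 2) t ≤
      -(δ / 4) - (a k i t * (V i x).1 * derivR (profilePotential (V 0) (V 1) (a k 0) (a k 1)
          (qProf f φ δ κ a V H k 0) (qProf f φ δ κ a V H k 1) (qProf f φ δ κ a V H k i) t) x +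
        a k i t * (V i x).2 * derivZ (profilePotential (V 0) (V 1) (a k 0) (a k 1)
          (qProf f φ δ κ a V H k 0) (qProf f φ δ κ a V H k 1) (qProf f φ δ κ a V H k i) t) x) := by
  have htS : t ∈ Ioo (-η) (T + η) := hηI ht
  rw [hQ.deriv_qProf_sq hposS hηI i ht x, ← hQ.link k i t x]
  have herr := hQ.abs_inner_error_le hg hε hK0 hK hB hposS i htS ht x
  set PQ := (V i x).1 * derivR (profilePotential (V 0) (V 1) (a k 0) (a k 1)
      (qProf f φ δ κ a V H k 0) (qProf f φ δ κ a V H k 1) (qProf f φ δ κ a V H k i) t) x +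
    (V i x).2 * derivZ (profilePotential (V 0) (V 1) (a k 0) (a k 1)
      (qProf f φ δ κ a V H k 0) (qProf f φ δ κ a V H k 1) (qProf f φ δ κ a V H k i) t) x with hPQ
  set PH := (V i x).1 * derivR (profilePotential (V 0) (V 1) (a k 0) (a k 1) (H 0) (H 1) (H i) t) x +
    (V i x).2 * derivZ (profilePotential (V 0) (V 1) (a k 0) (a k 1) (H 0) (H 1) (H i) t) x with hPH
  have hE : |PQ - PH| ≤ δ / 4 := herr.trans hεδ
  have ha : |a k i t| ≤ 1 := hQ.osc.abs_le k i t
  have h1 : |a k i t * (PQ - PH)| ≤ δ / 4 := by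
    rw [abs_mul]
    calc |a k i t| * |PQ - PH| ≤ 1 * (δ / 4) := mul_le_mul ha hE (abs_nonneg _) zero_le_one
      _ = δ / 4 := one_mul _
  have h2 := (abs_le.1 h1).2
  have hδ := hQ.δ_pos
  have hφ : δ / 2 ≤ 2 * δ * φ i x := by nlinarith
  have e : a k i t * (V i x).1 * derivR (profilePotential (V 0) (V 1) (a k 0) (a k 1)
        (qProf f φ δ κ a V H k 0) (qProf f φ δ κ a V H k 1) (qProf f φ δ κ a V H k i) t) x +
      a k i t * (V i x).2 * derivZ (profilePotential (V 0) (V 1) (a k 0) (a k 1)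
        (qProf f φ δ κ a V H k 0) (qProf f φ δ κ a V H k 1) (qProf f φ δ κ a V H k i) t) x = a k i t * PQ := by
    simp only [hPQ]; ring
  rw [e]
  have h3 : a k i t * (PQ - PH) = a k i t * PQ - a k i t * PH := by ring
  linarith

/-! ### Off `Cᵢ` (Scheffer (2.7)–(2.8); Ożański §4.2, Case 1) -/

/-- **Off `Cᵢ`: `∂ₜ(qᵏ_{i,t})²(x) = -2δφᵢ(x) ≤ 0`** (`vᵢ(x) = 0` for `φᵢ(x) < 1`; Scheffer (2.7)).
[cite: Ozanski2017NSISingular, §4.2 (Case 1)] [cite: Scheffer1985, Lemma 2.1 (2.7)] -/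
theorem outer_deriv (hQ : IsQData U V f φ ψ H T δ κ a) {k : ℕ} {η : ℝ}
    (hposS : ∀ i, ∀ t ∈ Ioo (-η) (T + η), ∀ x ∈ U i,
      (V i x).1 ^ 2 + (V i x).2 ^ 2 < qRad f φ δ κ a V H k i t x)
    (hηI : Icc (0 : ℝ) T ⊆ Ioo (-η) (T + η))
    (i : Fin 2) {t : ℝ} (ht : t ∈ Icc (0 : ℝ) T) {x : ℝ × ℝ} (hx : φ i x < 1) :
    deriv (fun s => qProf f φ δ κ a V H k i s x ^ 2) t ≤ 0 := by
  have hV := hQ.V_eq_zero_of_lt hx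
  rw [hQ.deriv_qProf_sq hposS hηI i ht x, gFam_eq_zero hV, fFam_eq_zero _ hV, fFam_eq_zero _ hV]
  have := (hQ.isNSIStructure i).φ_mem x
  nlinarith [hQ.δ_pos, this.1]

/-! ### The gain ((4.11) ⇒ Scheffer (2.2)) -/

/-- **The gain `qᵏ_{1,T} + qᵏ_{2,T} ≥ τ⁻¹(f₁ + f₂) ∘ R⁻¹` along `Γ`** on `G`, from (4.11) and
`|(qᵏ)² - h²| ≤ ε ≤ θ` at `t = T`. [cite: Ozanski2017NSISingular, §4 (after Prop. 4.2) and Lemma 4.1 (4.11)] -/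
theorem gain_qProf (hQ : IsQData U V f φ ψ H T δ κ a) {k : ℕ} {ε : ℝ} (hg : Good a V H T k ε)
    {τ : ℝ} (hτ : 0 < τ) {z : ℝ³} {θ : ℝ} (hεθ : ε ≤ θ)
    (hgain : ∀ x ∈ revolve (closure (U 0) ∪ closure (U 1)),
      τ⁻¹ ^ 2 * (f 0 (meridian x) + f 1 (meridian x)) ^ 2 + θ ≤ H 1 T (meridian (τ • x + z)) ^ 2)
    {x : ℝ³} (hx : x ∈ revolve (closure (U 0) ∪ closure (U 1))) :
    τ⁻¹ * (qProf f φ δ κ a V H k 0 0 (meridian x) + qProf f φ δ κ a V H k 1 0 (meridian x)) ≤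
      qProf f φ δ κ a V H k 0 T (meridian (τ • x + z)) +
        qProf f φ δ κ a V H k 1 T (meridian (τ • x + z)) := by
  have hT : T ∈ Icc (0 : ℝ) T := ⟨hQ.T_pos.le, le_rfl⟩
  rw [hQ.qProf_zero k 0, hQ.qProf_zero k 1]
  have h0 : 0 ≤ qProf f φ δ κ a V H k 0 T (meridian (τ • x + z)) := qProf_nonneg k 0 T _
  have hf : 0 ≤ τ⁻¹ * (f 0 (meridian x) + f 1 (meridian x)) :=
    mul_nonneg (inv_nonneg.2 hτ.le)
      (add_nonneg ((hQ.isNSIStructure 0).f_nonneg _) ((hQ.isNSIStructure 1).f_nonneg _))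
  have h1 : τ⁻¹ * (f 0 (meridian x) + f 1 (meridian x)) ≤
      qProf f φ δ κ a V H k 1 T (meridian (τ • x + z)) := by
    have e := hQ.qRad_sub_H_sq k 1 (hQ.κ_eq T hT) (meridian (τ • x + z))
    have hb := (abs_le.1 (hg T hT (meridian (τ • x + z)) 1).1).2
    have hgx := hgain x hx
    have hq : (τ⁻¹ * (f 0 (meridian x) + f 1 (meridian x))) ^ 2 ≤
        qRad f φ δ κ a V H k 1 T (meridian (τ • x + z)) := by
      rw [mul_pow]; linarith
    calc τ⁻¹ * (f 0 (meridian x) + f 1 (meridian x))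
        = Real.sqrt ((τ⁻¹ * (f 0 (meridian x) + f 1 (meridian x))) ^ 2) := (Real.sqrt_sq hf).symm
      _ ≤ qProf f φ δ κ a V H k 1 T (meridian (τ • x + z)) := Real.sqrt_le_sqrt hq
  linarith

/-! ### Assembly: profile data from the input of §4.1 -/

/-- The tolerance `ε > 0` with `ε < μ`, `ε ≤ θ` and `B(1 + 72K)ε ≤ δ/4`. [folklore] -/
theorem exists_tolerance {μ θ δ B K : ℝ} (hμ : 0 < μ) (hθ : 0 < θ) (hδ : 0 < δ) (hB : 0 ≤ B)
    (hK : 0 ≤ K) : ∃ ε : ℝ, 0 < ε ∧ ε < μ ∧ ε ≤ θ ∧ B * (1 + 72 * K) * ε ≤ δ / 4 := by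
  set W : ℝ := B * (1 + 72 * K) + 1 with hW
  have hW1 : 1 ≤ W := by simp only [hW]; nlinarith
  have hWpos : 0 < W := by linarith
  refine ⟨min (min (μ / 2) θ) (δ / (4 * W)), lt_min (lt_min (by positivity) hθ) (by positivity),
    lt_of_le_of_lt ((min_le_left _ _).trans (min_le_left _ _)) (by linarith),
    (min_le_left _ _).trans (min_le_right _ _), ?_⟩
  have h1 : min (min (μ / 2) θ) (δ / (4 * W)) ≤ δ / (4 * W) := min_le_right _ _
  have h2 : B * (1 + 72 * K) ≤ W := by simp only [hW]; linarith
  have h3 : 0 ≤ B * (1 + 72 * K) := by positivity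
  calc B * (1 + 72 * K) * min (min (μ / 2) θ) (δ / (4 * W)) ≤ W * (δ / (4 * W)) :=
        mul_le_mul h2 h1 (le_min (le_min (by positivity) hθ.le) (by positivity)) hWpos.le
    _ = δ / 4 := by field_simp

/-- **Proposition 4.2 / Lemma 3.3, the data: the input of §4.1 yields profile data** in the sense
of `IsNSIProfileData` — margin `η` from the tube lemma, slack `δ/4`, closed sets
`Cᵢ = {φᵢ ≥ 1/4}`, directions `aᵢᵏ` and profiles `qᵏᵢ` for a good `k` (Ożański: "the vector
field (4.17) is a solution to Proposition 4.2 for sufficiently large `k`"; Scheffer, Lemma 3.3).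
[cite: Ozanski2017NSISingular, Prop. 4.2 and §4.1–4.2] [cite: Scheffer1985, Lemma 3.3] -/
theorem exists_profileData (hQ : IsQData U V f φ ψ H T δ κ a) {τ : ℝ} (hτ : 0 < τ) {z : ℝ³}
    {θ : ℝ} (hθ : 0 < θ)
    (hgain : ∀ x ∈ revolve (closure (U 0) ∪ closure (U 1)),
      τ⁻¹ ^ 2 * (f 0 (meridian x) + f 1 (meridian x)) ^ 2 + θ ≤ H 1 T (meridian (τ • x + z)) ^ 2) :
    ∃ (η δ' : ℝ) (C₀ C₁ : Set (ℝ × ℝ)) (a₀ a₁ : ℝ → ℝ) (Q₀ Q₁ : ℝ → ℝ × ℝ → ℝ),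
      IsNSIProfileData (U 0) (U 1) (V 0) (V 1) (f 0) (f 1) T τ z η δ' C₀ C₁ a₀ a₁ Q₀ Q₁ := by
  obtain ⟨μ, hμ, hμle⟩ := hQ.exists_margin
  obtain ⟨B, hB0, hB⟩ := hQ.exists_abs_V_le
  obtain ⟨K, hK0, hK⟩ := exists_pressure_constant U
  have hδ := hQ.δ_pos
  obtain ⟨ε, hεpos, hεμ, hεθ, hεδ⟩ := exists_tolerance hμ hθ hδ hB0 hK0
  obtain ⟨Kk, hKk⟩ := hQ.exists_good hεpos
  have hg : Good a V H T Kk ε := hKk Kk le_rfl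
  have hposT : ∀ i, ∀ t ∈ Icc (0 : ℝ) T, ∀ x ∈ U i,
      (V i x).1 ^ 2 + (V i x).2 ^ 2 < qRad f φ δ κ a V H Kk i t x :=
    fun i t ht x hx => hQ.sq_lt_qRad_of_mem_Icc hg hμle hεμ i ht hx
  obtain ⟨η, hη, hposS⟩ := hQ.exists_eta Kk hposT
  have hηI : Icc (0 : ℝ) T ⊆ Ioo (-η) (T + η) := fun t ht => ⟨by linarith [ht.1], by linarith [ht.2]⟩
  have hκI : ∀ t ∈ Icc (0 : ℝ) T, κ t ∈ Icc (-1 : ℝ) (T + 1) := fun t ht => by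
    rw [hQ.κ_eq t ht]; exact ⟨by linarith [ht.1], by linarith [ht.2]⟩
  have hS0 := hQ.isNSIStructure 0
  have hS1 := hQ.isNSIStructure 1
  refine ⟨η, δ / 4, {x | 1 / 4 ≤ φ 0 x}, {x | 1 / 4 ≤ φ 1 x}, a Kk 0, a Kk 1,
    qProf f φ δ κ a V H Kk 0, qProf f φ δ κ a V H Kk 1, ?_⟩
  exact
    { η_pos := hη
      δ_pos := by positivity
      a₁_smooth := hQ.osc.contDiff Kk 0
      a₂_smooth := hQ.osc.contDiff Kk 1
      abs_a₁_le := fun t => hQ.osc.abs_le Kk 0 t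
      abs_a₂_le := fun t => hQ.osc.abs_le Kk 1 t
      isClosed₁ := isClosed_le continuous_const hS0.φ_smooth.continuous
      isClosed₂ := isClosed_le continuous_const hS1.φ_smooth.continuous
      subset₁ := hS0.setOf_le_φ_subset
      subset₂ := hS1.setOf_le_φ_subset
      tsupport_v₁ := fun x hx => by
        have h1 : φ 0 x = 1 := hS0.tsupport_v hx
        show (1 : ℝ) / 4 ≤ φ 0 x
        rw [h1]; norm_num
      tsupport_v₂ := fun x hx => by
        have h1 : φ 1 x = 1 := hS1.tsupport_v hx
        show (1 : ℝ) / 4 ≤ φ 1 x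
        rw [h1]; norm_num
      Q₁_smooth := hQ.contDiffOn_qProf Kk 0 (hposS 0)
      Q₂_smooth := hQ.contDiffOn_qProf Kk 1 (hposS 1)
      Q₁_nonneg := fun t _ x => qProf_nonneg Kk 0 t x
      Q₂_nonneg := fun t _ x => qProf_nonneg Kk 1 t x
      Q₁_eq_zero := fun t _ x hx => hQ.qProf_eq_zero Kk 0 t hx
      Q₂_eq_zero := fun t _ x hx => hQ.qProf_eq_zero Kk 1 t hx
      sq_lt₁ := fun t ht x hx => by
        rw [qProf_sq (hQ.qRad_nonneg Kk 0 (hposS 0 t ht) x)]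
        exact hposS 0 t ht x hx
      sq_lt₂ := fun t ht x hx => by
        rw [qProf_sq (hQ.qRad_nonneg Kk 1 (hposS 1 t ht) x)]
        exact hposS 1 t ht x hx
      initial₁ := fun x => hQ.qProf_zero Kk 0 x
      initial₂ := fun x => hQ.qProf_zero Kk 1 x
      inner₁ := fun t ht x hx => hQ.inner_ineq hg hεpos.le hK0 hK hB hεδ hposS hηI 0 ht hx
      inner₂ := fun t ht x hx => hQ.inner_ineq hg hεpos.le hK0 hK hB hεδ hposS hηI 1 ht hx
      outer₁ := fun t ht x hx =>
        hQ.outer_deriv hposS hηI 0 ht (lt_of_lt_of_le (not_le.1 hx) (by norm_num))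
      outer₂ := fun t ht x hx =>
        hQ.outer_deriv hposS hηI 1 ht (lt_of_lt_of_le (not_le.1 hx) (by norm_num))
      opL₁ := fun t ht x hx _ => mul_nonneg (qProf_nonneg Kk 0 t x)
        ((hQ.crit_qProf 0 (hposS 0) (hηI ht) (hκI t ht)).2.1 x (not_le.1 hx))
      opL₂ := fun t ht x hx _ => mul_nonneg (qProf_nonneg Kk 1 t x)
        ((hQ.crit_qProf 1 (hposS 1) (hηI ht) (hκI t ht)).2.1 x (not_le.1 hx))
      gain := fun x hx => hQ.gain_qProf hg hτ hεθ hgain hx }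

end IsQData

/-! ### From an arrangement: Lemma 4.1 + Theorem 4.3 ⇒ the input of §4.1 ⇒ profile data -/

section Arrangement

variable {U₁ U₂ : Set (ℝ × ℝ)} {v₁ : ℝ × ℝ → ℝ × ℝ} {f₁ φ₁ : ℝ × ℝ → ℝ} {v₂ : ℝ × ℝ → ℝ × ℝ}
  {f₂ φ₂ : ℝ × ℝ → ℝ} {T τ : ℝ} {z : ℝ³}

/-- **The input of §4.1 from an arrangement**: the data of Lemma 4.1 (`IsHProfileData`) and an
oscillatory family (Theorem 4.3) give `IsQData` for the `Fin 2`-indexed families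
`![U₁,U₂], ![v₁,v₂], ![f₁,f₂], ![φ₁,φ₂], ![ψ₁,ψ₂], ![h₁,h₂]`.
[cite: Ozanski2017NSISingular, Lemma 4.1 and Theorem 4.3] -/
theorem IsHProfileData.isQData {δ : ℝ} {κ : ℝ → ℝ} {ψ₁ ψ₂ : ℝ × ℝ → ℝ} {m₁ m₂ θ : ℝ}
    (hA : IsNSIArrangement U₁ U₂ v₁ f₁ φ₁ v₂ f₂ φ₂ T τ z)
    (hH : IsHProfileData U₁ U₂ v₁ v₂ f₁ φ₁ f₂ φ₂ T τ z δ κ ψ₁ ψ₂ m₁ m₂ θ)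
    {a : ℕ → Fin 2 → ℝ → ℝ} (ha : IsOscFamily T a) :
    IsQData ![U₁, U₂] ![v₁, v₂] ![f₁, f₂] ![φ₁, φ₂] ![ψ₁, ψ₂]
      ![hProfile₁ f₁ φ₁ δ κ, hProfile₂ v₁ v₂ f₁ φ₁ f₂ φ₂ δ κ] T δ κ a := by
  have h₁S := hA.structure₁
  have h₂S := hA.structure₂
  -- (4.9) for `h₂` in the expanded form: the interaction integral is `-oscLimit`
  have hrate : ∀ s x, fFam ![v₁, v₂] ![hProfile₁ f₁ φ₁ δ κ, hProfile₂ v₁ v₂ f₁ φ₁ f₂ φ₂ δ κ] 1 0 s x =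
      -2 * interactionRate v₁ v₂ f₁ φ₁ δ κ s x := fun s x => by
    simp only [fFam, interactionRate, Matrix.cons_val_one, Matrix.cons_val_zero]
  refine
    { isNSIStructure := Fin.forall_fin_two.2 ⟨h₁S, h₂S⟩
      δ_pos := hH.δ_pos
      T_pos := hH.T_pos
      κ_smooth := hH.κ_smooth
      κ_eq := hH.κ_eq
      deriv_κ_eq := hH.deriv_κ_eq
      κ_mem := hH.κ_mem_Icc
      gap := Fin.forall_fin_two.2 ⟨⟨m₁, hH.m₁_pos, hH.gap₁⟩, ⟨m₂, hH.m₂_pos, hH.gap₂⟩⟩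
      crit := Fin.forall_fin_two.2 ⟨hH.crit₁, hH.crit₂⟩
      H_smooth := Fin.forall_fin_two.2 ⟨hH.contDiff_hProfile₁, hH.contDiff_hProfile₂ h₁S h₂S⟩
      H_str := Fin.forall_fin_two.2 ⟨fun t b hb => hH.isNSIStructure₁ t hb,
        fun t b hb => hH.isNSIStructure₂ h₁S h₂S t hb⟩
      H_sq := Fin.forall_fin_two.2 ⟨fun t x => ?_, fun t x => ?_⟩
      osc := ha }
  · show hProfile₁ f₁ φ₁ δ κ t x ^ 2 = f₁ x ^ 2 - 2 * κ t * δ * φ₁ x - oscLimit _ 0 (κ t) x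
    rw [hH.hProfile₁_sq]
    simp [oscLimit]
  · show hProfile₂ v₁ v₂ f₁ φ₁ f₂ φ₂ δ κ t x ^ 2 = f₂ x ^ 2 - 2 * κ t * δ * φ₂ x - oscLimit _ 1 (κ t) x
    rw [hH.hProfile₂_sq h₂S, hRadicand₂]
    simp only [oscLimit, if_true]
    have e : (fun s => fFam ![v₁, v₂] ![hProfile₁ f₁ φ₁ δ κ, hProfile₂ v₁ v₂ f₁ φ₁ f₂ φ₂ δ κ] 1 0 s x) =
        fun s => -2 * interactionRate v₁ v₂ f₁ φ₁ δ κ s x := funext fun s => hrate s x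
    rw [e, intervalIntegral.integral_const_mul]
    ring

/-- **Every geometric arrangement carries profile data** (Ożański 2017, §4.1: Lemma 4.1, the
profiles (4.16) driven by the oscillatory processes of Theorem 4.3, verified in §4.2; Scheffer
1985, Lemmas 3.1–3.3) — the content of fact D-II `NSIProfiles_of_arrangement`.
[cite: Ozanski2017NSISingular, §4.1–4.2 (Lemma 4.1, (4.16)–(4.20), Prop. 4.2)] [cite: Scheffer1985, Lemmas 3.1–3.3] -/
theorem IsNSIArrangement.exists_profileData (hA : IsNSIArrangement U₁ U₂ v₁ f₁ φ₁ v₂ f₂ φ₂ T τ z) :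
    ∃ (η δ : ℝ) (C₁ C₂ : Set (ℝ × ℝ)) (a₁ a₂ : ℝ → ℝ) (Q₁ Q₂ : ℝ → ℝ × ℝ → ℝ),
      IsNSIProfileData U₁ U₂ v₁ v₂ f₁ f₂ T τ z η δ C₁ C₂ a₁ a₂ Q₁ Q₂ := by
  obtain ⟨δ, κ, ψ₁, ψ₂, m₁, m₂, θ, hH⟩ := hA.exists_hProfileData
  obtain ⟨a, ha⟩ := exists_isOscFamily hA.T_pos
  have hQ := hH.isQData hA ha
  exact hQ.exists_profileData hA.τ_mem.1 hH.θ_pos hH.gain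

end Arrangement

end Literature.Barriers.NavierStokesRegularity
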